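import Literature.NumberTheory.LFunctions.LandauFunctionUpperReduction
import Literature.NumberTheory.LFunctions.RobinLiThetaCriterionRH
import Literature.NumberTheory.LFunctions.LogIntegralAsymptoticsProofs
import Mathlib.NumberTheory.AbelSummation
import Mathlib.Analysis.SpecialFunctions.Pow.Asymptotics
import Mathlib.Analysis.SpecialFunctions.Integrals.Basic
import HarnessLib

/-!
RH-CONDITIONAL (MNR 1988 Thm. 1 (iv): `RH ⟹ log g(n) < √(li⁻¹(n))` for `n` large; Thm. 1 (i)
under RH: `RH ⟹ |log g(n) − √(li⁻¹(n))| ≤ 60 (n log n)^{1/4}` for `n` large),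
RH-EQUIVALENT (the named fact `MassiasNicolasRobin1988_iff` DISCHARGED:
`MassiasNicolasRobin1988_iff_holds`) and RH-FREE (§9: MNR's two-layer numbers `N_ρ`, §4 (3)–(6));
nothing here bears on the truth of RH — implications from RH and an equivalence are proved, neither
side is asserted.

# Landau's function under RH: `log g(n) < √(li⁻¹(n))` for large `n` (MNR 1988, Thm. 1 (iv))

Literature-typing tranche 1 (Broughan vol. 1, Ch. 10, the symmetric-group criterion). With the
RH-free reduction of `LandauFunctionUpperReduction.lean`
(`li((log k)²) − ℓ(k) ≤ li(T(x)²) − L₂(x) + 10x^{4/3}`, `x = log k`) it remains to show, under RH,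

  `li(T(x)²) − L₂(x) ≤ −c · x^{3/2}/log x`  for large `x`                                  (∗)

(`T(x) = θ(x) + Σ_{p ∈ A₂(x)} log p`, `L₂(x) = Σ_{p≤x} p + Σ_{p∈A₂(x)} (p² − p)`,
`A₂(x) = {p ≤ x : p² − p ≤ (x/log x) log p}`), which is MNR's computation of §6 ("(iv)": the main
terms `x₁^{3/2}/log x₁` of `Li(log² N_ρ)` and of `ℓ(N_ρ)` differ by the negative constant
`−(2 − √2)/3`, cf. Thm. 1 (v)) done with the explicit RH estimates of the tree:
von Koch's `θ(x) = x + O(√x log²x)` (`LiThetaRH.exists_abs_theta_sub_le_of_RH`, from the tree's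
PROVED `vonKoch_chebyshevPsi_of_riemannHypothesis_holds`, MV Thm. 13.1) and
`|ψ₁(x) − x²/2| ≤ 0.05 x^{3/2}` (`LiThetaRH.exists_abs_psiOneErr_le_of_RH`, MV (13.8)).

Route for (∗) (`J(t) = li(t²) − li(4)`, `w(t) = t/log t`, `π₁(x) = Σ_{p≤x} p`):
* Abel summation: `π₁(x) = θ(x)w(x) − ∫₂ˣ θ w′`, `J(x) = x w(x) − 2w(2) − ∫₂ˣ t w′(t) dt`, so
  `π₁(x) − J(x) = (θ(x) − x)w(x) + 2w(2) − ∫₂ˣ (θ(t) − t) w′(t) dt`;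
* tangent inequalities for the convex `J`: `J(θ(x)) − J(x) ≤ (θ(x) − x) w(x) + E(x)²/log x` and
  `J(T) − J(θ) ≤ (T − θ) T/log T`;
* `∫₂ˣ (θ − t) w′ = ∫₂ˣ (ψ − t) w′ − ∫₂ˣ (ψ − θ) w′`, where `∫(ψ − t)w′ ≤ (0.05 + o(1)) x^{3/2}/log x`
  (integration by parts to `ψ₁`, whose right derivative is `ψ`) and
  `∫(ψ − θ) w′ ≥ ∫ θ(√t) w′ ≥ (2/3 − o(1)) x^{3/2}/log x`;
* `A₂(x) ⊆ {p ≤ √(0.505 x)}` and `A₂(x) ⊇ {p ≤ v}`, `v² = (x/2)(1 − (1 + log log x)/log x)`, whence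
  `T − θ(x) ≤ θ(√(0.505x))` and `L₂(x) − π₁(x) ≥ Σ_{p ≤ v} (p² − p) ≥ (0.33 − o(1)) v³/log v`
  (Abel summation for `Σ p²`);
* numerically `0.714 + 0.06 − 0.655 − 0.20 < 0`.
Then `MassiasNicolasRobin1988_iff_holds` combines (∗), the reduction, `ℓ(g(n)) ≤ n` and the
already proved `⟸` half (`LandauFnOmega.riemannHypothesis_of_eventually_log_landauFn_lt`).

§§9–11 (appended): the two-layer numbers `N_ρ = ∏_{p≤x} p^{α_p}` of MNR §4 (3) (`enn`, `ℓ(N_ρ) = L₂(x)`,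
`log N_ρ = T(x)`, `N_ρ ∈ g(ℕ)`: `bigT_le_log_landauFn`; (5)–(6): `pow_expo_le`, `theta_le_log_enn`,
`log_enn_le_psi`), the reverse estimate `L₂(x) ≤ li(T(x)²) + 36 x^{3/2}/log x` under RH
(`lTwo_le_logIntegral_bigT_sq`, from `∫(ψ − t)w′ ≥ −0.06Q`, `∫(ψ − θ)w′ ≤ 35Q`, `L₂ − π₁ ≤ 0.75Q`), the
jump bound `L₂(m+1) − L₂(m) ≤ 2(m+1)` (`lTwo_succ_sub_le`: at most one prime enters the second layer),
and **MNR Thm. 1 (i) under RH, lower half**: `sqrt_sub_rpow_le_log_landauFn_of_riemannHypothesis`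
(`RH ⟹ log g(n) ≥ √y − 38 y^{1/4}`, `li y = n`, for all large `n`); §12 converts to the printed scale
(`li⁻¹ n ≤ 6 n log n` from `li y ∼ y/log y`): `abs_log_landauFn_sub_sqrt_le_of_riemannHypothesis`,
**RH ⟹ |log g(n) − √(li⁻¹ n)| ≤ 60 (n log n)^{1/4} for all large n** (MNR Thm. 1 (i), `θ = 1/2`).

## References
* [MNR 1988] Massias–Nicolas–Robin, Acta Arith. 50 (1988) 221–242, Thm. 1 (iv), §4, §6.
* [Koch1901] H. von Koch, *Sur la distribution des nombres premiers*, Acta Math. 24 (1901).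
* [MontgomeryVaughan2007] Thm. 13.1, (13.6)–(13.8).
-/

open Real Filter Set MeasureTheory
open scoped Chebyshev

namespace Literature.NumberTheory.LFunctions

namespace LandauFnUpperRH

open LandauFnUpper LandauFnOmega

/-! ## §1 Helpers: `log^n = o(x^s)`, derivatives, continuity -/

/-- eventually `log^n x ≤ ε x^s`. [folklore] -/
private theorem exists_log_pow_le (n : ℕ) {s ε : ℝ} (hs : 0 < s) (hε : 0 < ε) :
    ∃ X : ℝ, ∀ x, X ≤ x → Real.log x ^ n ≤ ε * x ^ s := by
  have h := (isLittleO_log_rpow_rpow_atTop (n : ℝ) hs).def hε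
  rw [Filter.eventually_atTop] at h
  obtain ⟨X, hX⟩ := h
  refine ⟨max X 1, fun x hx ↦ ?_⟩
  have hx1 : 1 ≤ x := (le_max_right _ _).trans hx
  have h1 := hX x ((le_max_left _ _).trans hx)
  have hl : 0 ≤ Real.log x := Real.log_nonneg hx1
  rwa [Real.rpow_natCast, Real.norm_eq_abs, Real.norm_eq_abs, abs_of_nonneg (pow_nonneg hl n),
    abs_of_nonneg (Real.rpow_nonneg (by linarith) s)] at h1

/-- `w(t) = t/log t`. [cite: MassiasNicolasRobin1988, §6 (x₁/log x₁)] -/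
noncomputable def w (t : ℝ) : ℝ := t / Real.log t

/-- `w′(t) = (log t − 1)/log² t`. [folklore] -/
noncomputable def w1 (t : ℝ) : ℝ := (Real.log t - 1) / Real.log t ^ 2

/-- `w″(t) = (2 − log t)/(t log³ t)`. [folklore] -/
noncomputable def w2 (t : ℝ) : ℝ := (2 - Real.log t) / (t * Real.log t ^ 3)

/-- `f₂(t) = t²/log t`. [folklore] -/
noncomputable def f2 (t : ℝ) : ℝ := t ^ 2 / Real.log t

/-- `f₂′(t) = (2t log t − t)/log² t`. [folklore] -/
noncomputable def f2d (t : ℝ) : ℝ := (2 * t * Real.log t - t) / Real.log t ^ 2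

/-- `w' = w1` on `t > 1`. [folklore] -/
private theorem hasDerivAt_w {t : ℝ} (ht : 1 < t) : HasDerivAt w (w1 t) t := by
  have ht0 : t ≠ 0 := by positivity
  have hl : Real.log t ≠ 0 := (Real.log_pos ht).ne'
  have h := (hasDerivAt_id' t).div (Real.hasDerivAt_log ht0) hl
  have e : (1 * Real.log t - t * t⁻¹) / Real.log t ^ 2 = w1 t := by
    rw [w1, mul_inv_cancel₀ ht0, one_mul]
  exact h.congr_deriv e

/-- `w1' = w2` on `t > 1`. [folklore] -/
private theorem hasDerivAt_w1 {t : ℝ} (ht : 1 < t) : HasDerivAt w1 (w2 t) t := by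
  have ht0 : t ≠ 0 := by positivity
  have hl : Real.log t ≠ 0 := (Real.log_pos ht).ne'
  have h1 : HasDerivAt (fun t : ℝ ↦ Real.log t - 1) (t⁻¹) t :=
    (Real.hasDerivAt_log ht0).sub_const 1
  have h2 : HasDerivAt (fun t : ℝ ↦ Real.log t ^ 2) ((2:ℕ) * Real.log t ^ (2 - 1) * t⁻¹) t :=
    (Real.hasDerivAt_log ht0).pow 2
  have h := h1.div h2 (pow_ne_zero 2 hl)
  have e : (t⁻¹ * Real.log t ^ 2 - (Real.log t - 1) * ((2:ℕ) * Real.log t ^ (2 - 1) * t⁻¹))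
      / (Real.log t ^ 2) ^ 2 = w2 t := by
    rw [w2, div_eq_div_iff (pow_ne_zero 2 (pow_ne_zero 2 hl)) (mul_ne_zero ht0 (pow_ne_zero 3 hl))]
    push_cast
    field_simp
    ring
  exact h.congr_deriv e

/-- `f2' = f2d` on `t > 1`. [folklore] -/
private theorem hasDerivAt_f2 {t : ℝ} (ht : 1 < t) : HasDerivAt f2 (f2d t) t := by
  have ht0 : t ≠ 0 := by positivity
  have hl : Real.log t ≠ 0 := (Real.log_pos ht).ne'
  have h := (hasDerivAt_pow 2 t).div (Real.hasDerivAt_log ht0) hl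
  have e : ((2:ℕ) * t ^ (2 - 1) * Real.log t - t ^ 2 * t⁻¹) / Real.log t ^ 2 = f2d t := by
    rw [f2d]
    congr 1
    push_cast
    field_simp
  exact h.congr_deriv e

/-- continuity of `w1` at `t > 1`. [folklore] -/
private theorem continuousAt_w1 {t : ℝ} (ht : 1 < t) : ContinuousAt w1 t :=
  (hasDerivAt_w1 ht).continuousAt

/-- continuity of `w2` at `t > 1`. [folklore] -/
private theorem continuousAt_w2 {t : ℝ} (ht : 1 < t) : ContinuousAt w2 t := by
  have ht0 : t ≠ 0 := by positivity
  have hl : Real.log t ≠ 0 := (Real.log_pos ht).ne'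
  unfold w2
  exact (continuousAt_const.sub (Real.continuousAt_log ht0)).div
    (continuousAt_id.mul ((Real.continuousAt_log ht0).pow 3)) (mul_ne_zero ht0 (pow_ne_zero 3 hl))

/-- continuity of `f2d` at `t > 1`. [folklore] -/
private theorem continuousAt_f2d {t : ℝ} (ht : 1 < t) : ContinuousAt f2d t := by
  have ht0 : t ≠ 0 := by positivity
  have hl : Real.log t ≠ 0 := (Real.log_pos ht).ne'
  unfold f2d
  exact (((continuousAt_const.mul continuousAt_id).mul (Real.continuousAt_log ht0)).sub
    continuousAt_id).div ((Real.continuousAt_log ht0).pow 2) (pow_ne_zero 2 hl)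

/-- continuity of `w` at `t > 1`. [folklore] -/
private theorem continuousAt_w {t : ℝ} (ht : 1 < t) : ContinuousAt w t :=
  (hasDerivAt_w ht).continuousAt

/-- continuity of `f2` at `t > 1`. [folklore] -/
private theorem continuousAt_f2 {t : ℝ} (ht : 1 < t) : ContinuousAt f2 t :=
  (hasDerivAt_f2 ht).continuousAt

/-- pointwise continuity beyond `1` gives continuity on `[a, b]`, `a > 1`. [folklore] -/
private theorem continuousOn_of_continuousAt {f : ℝ → ℝ} {a b : ℝ} (ha : 1 < a)
    (h : ∀ t : ℝ, 1 < t → ContinuousAt f t) : ContinuousOn f (Set.Icc a b) :=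
  fun t ht ↦ (h t (by linarith [ht.1])).continuousWithinAt

/-- pointwise continuity beyond `1` gives interval integrability on `[a, b]`, `a > 1`. [folklore] -/
private theorem intervalIntegrable_of_continuousAt {f : ℝ → ℝ} {a b : ℝ} (ha : 1 < a) (hab : a ≤ b)
    (h : ∀ t : ℝ, 1 < t → ContinuousAt f t) : IntervalIntegrable f volume a b :=
  (ContinuousOn.intervalIntegrable_of_Icc hab (continuousOn_of_continuousAt ha h))

/-! ## §2 Abel summation identities -/

/-- `a(n) = log n · 1_{n prime}` (partial sums `θ`). [folklore] -/
private noncomputable def aP (n : ℕ) : ℝ := if n.Prime then Real.log n else 0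

/-- the partial sums of `a` are `θ`. [folklore] -/
private theorem sum_aP (t : ℝ) : ∑ k ∈ Finset.Icc 0 ⌊t⌋₊, aP k = θ t := by
  rw [Chebyshev.theta_eq_sum_Icc, Finset.sum_filter]; rfl

/-- Abel summation against `θ`: for `F` with derivative `F'` (continuous) on `[2, x]`,
`Σ_{p ≤ x} F(p) log p = θ(x) F(x) − ∫₂ˣ θ F'`. [cite: Apostol1976, Thm. 4.2 (Abel's identity)] -/
theorem sum_primesLE_mul_log_eq {F F' : ℝ → ℝ} {x : ℝ} (hx : 2 ≤ x)
    (hF : ∀ t : ℝ, 1 < t → HasDerivAt F (F' t) t) (hF' : ∀ t : ℝ, 1 < t → ContinuousAt F' t) :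
    ∑ p ∈ Nat.primesLE ⌊x⌋₊, F p * Real.log p = θ x * F x - ∫ t in (2:ℝ)..x, θ t * F' t := by
  have hdiff : ∀ t ∈ Set.Icc 2 x, DifferentiableAt ℝ F t :=
    fun t ht ↦ (hF t (by linarith [ht.1])).differentiableAt
  have hcont : ContinuousOn F' (Set.Icc 2 x) := continuousOn_of_continuousAt one_lt_two hF'
  have hint : IntegrableOn (deriv F) (Set.Icc 2 x) :=
    (hcont.integrableOn_Icc).congr_fun (fun t ht ↦ ((hF t (by linarith [ht.1])).deriv).symm)
      measurableSet_Icc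
  have hA := sum_mul_eq_sub_integral_mul₁ aP (by simp [aP, Nat.not_prime_zero])
    (by simp [aP, Nat.not_prime_one]) x hdiff hint
  simp only [sum_aP] at hA
  have hL : ∑ k ∈ Finset.Icc 0 ⌊x⌋₊, F k * aP k = ∑ p ∈ Nat.primesLE ⌊x⌋₊, F p * Real.log p := by
    rw [Nat.primesLE_eq_filter_Icc_zero, Finset.sum_filter]
    refine Finset.sum_congr rfl fun k _ ↦ ?_
    unfold aP; split_ifs <;> simp
  rw [← hL, hA, intervalIntegral.integral_of_le hx]
  congr 1
  · ring
  · refine setIntegral_congr_fun measurableSet_Ioc fun t ht ↦ ?_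
    rw [(hF t (by linarith [ht.1])).deriv]; ring

/-- **`π₁(x) = θ(x)·x/log x − ∫₂ˣ θ(t) w′(t) dt`**. [cite: MassiasNicolasRobin1988, §5 (Stieltjes integration of Π_r)] -/
theorem primeSum_eq {x : ℝ} (hx : 2 ≤ x) :
    (primeSum ⌊x⌋₊ : ℝ) = θ x * w x - ∫ t in (2:ℝ)..x, θ t * w1 t := by
  have h := sum_primesLE_mul_log_eq hx (fun t ht ↦ hasDerivAt_w ht) (fun t ht ↦ continuousAt_w1 ht)
  rw [← h, primeSum]
  push_cast
  refine Finset.sum_congr rfl fun p hp ↦ ?_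
  have hp2 : (2:ℝ) ≤ p := by exact_mod_cast (Nat.mem_primesLE.1 hp).2.two_le
  have hl : Real.log p ≠ 0 := (Real.log_pos (by linarith)).ne'
  rw [w, div_mul_cancel₀ _ hl]

/-- **`Σ_{p ≤ v} p² = θ(v)·v²/log v − ∫₂ᵛ θ(t) f₂′(t) dt`**. [cite: Apostol1976, Thm. 4.2 (Abel's identity)] -/
theorem sum_sq_eq {v : ℝ} (hv : 2 ≤ v) :
    ∑ p ∈ Nat.primesLE ⌊v⌋₊, ((p:ℝ) ^ 2) = θ v * f2 v - ∫ t in (2:ℝ)..v, θ t * f2d t := by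
  have h := sum_primesLE_mul_log_eq hv (fun t ht ↦ hasDerivAt_f2 ht) (fun t ht ↦ continuousAt_f2d ht)
  rw [← h]
  refine Finset.sum_congr rfl fun p hp ↦ ?_
  have hp2 : (2:ℝ) ≤ p := by exact_mod_cast (Nat.mem_primesLE.1 hp).2.two_le
  have hl : Real.log p ≠ 0 := (Real.log_pos (by linarith)).ne'
  rw [f2, div_mul_cancel₀ _ hl]

/-- continuity of `J` (copy of the private lemma of `LandauFunctionOmega`). [folklore] -/
private theorem continuous_liSq : Continuous liSq := by
  unfold liSq
  refine Continuous.sub ?_ continuous_const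
  have h : Continuous fun x : ℝ ↦ max 2 x ^ 2 := (continuous_const.max continuous_id).pow 2
  exact continuousOn_offsetLogIntegral.comp_continuous h fun x ↦ by
    show (1 : ℝ) < max 2 x ^ 2
    nlinarith [le_max_left (2 : ℝ) x]

/-- `J(2) = 0`. [folklore] -/
private theorem liSq_two : liSq 2 = 0 := by
  unfold liSq; norm_num

/-- **`J(x) = x w(x) − 2 w(2) − ∫₂ˣ t w′(t) dt`** (`J = ∫₂ˣ w`, by parts).
[cite: MassiasNicolasRobin1988, §5 (18)] -/
theorem liSq_eq {x : ℝ} (hx : 2 ≤ x) :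
    liSq x = x * w x - 2 * w 2 - ∫ t in (2:ℝ)..x, t * w1 t := by
  -- `J(x) = ∫₂ˣ w`
  have h1 : ∫ t in (2:ℝ)..x, w t = liSq x - liSq 2 := by
    refine intervalIntegral.integral_eq_sub_of_hasDerivAt_of_le hx continuous_liSq.continuousOn
      (fun t ht ↦ ?_) (intervalIntegrable_of_continuousAt one_lt_two hx fun t ht ↦ continuousAt_w ht)
    have := hasDerivAt_liSq (show (2:ℝ) < t from ht.1)
    simpa [w] using this
  -- by parts `∫ 1·w = [t w] − ∫ t w'`
  have h2 : ∫ t in (2:ℝ)..x, t * w1 t = x * w x - 2 * w 2 - ∫ t in (2:ℝ)..x, w t := by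
    have := intervalIntegral.integral_mul_deriv_eq_deriv_mul (a := 2) (b := x) (u := fun t : ℝ ↦ t)
      (u' := fun _ ↦ (1:ℝ)) (v := w) (v' := w1) (fun t ht ↦ hasDerivAt_id' t)
      (fun t ht ↦ hasDerivAt_w (by rw [Set.uIcc_of_le hx] at ht; linarith [ht.1]))
      intervalIntegrable_const
      (intervalIntegrable_of_continuousAt one_lt_two hx fun t ht ↦ continuousAt_w1 ht)
    simpa using this
  rw [liSq_two, sub_zero] at h1
  linarith

/-- **`π₁(x) − J(x) = (θ(x) − x) w(x) + 2w(2) − ∫₂ˣ (θ(t) − t) w′(t) dt`**.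
[cite: MassiasNicolasRobin1988, §5 Lemme C (i) (r = 1)] -/
theorem primeSum_sub_liSq_eq {x : ℝ} (hx : 2 ≤ x) :
    (primeSum ⌊x⌋₊ : ℝ) - liSq x
      = (θ x - x) * w x + 2 * w 2 - ∫ t in (2:ℝ)..x, (θ t - t) * w1 t := by
  have hθ : IntervalIntegrable (fun t ↦ θ t * w1 t) volume 2 x :=
    (Chebyshev.theta_mono.intervalIntegrable).mul_continuousOn
      (by rw [Set.uIcc_of_le hx]; exact continuousOn_of_continuousAt one_lt_two fun t ht ↦ continuousAt_w1 ht)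
  have hid : IntervalIntegrable (fun t : ℝ ↦ t * w1 t) volume 2 x :=
    intervalIntegrable_of_continuousAt one_lt_two hx fun t ht ↦
      (continuousAt_id.mul (continuousAt_w1 ht))
  have hsplit : ∫ t in (2:ℝ)..x, (θ t - t) * w1 t
      = (∫ t in (2:ℝ)..x, θ t * w1 t) - ∫ t in (2:ℝ)..x, t * w1 t := by
    rw [← intervalIntegral.integral_sub hθ hid]
    refine intervalIntegral.integral_congr fun t _ ↦ ?_
    show _ = _ - _; ring
  rw [primeSum_eq hx, liSq_eq hx, hsplit]
  ring


/-! ## §3 Tangent bounds for the convex function `J(t) = li(t²) − li(4)` -/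

/-- `x/log x ≤ c/log c` for `e ≤ x ≤ c`. [folklore] -/
private theorem div_log_mono {x c : ℝ} (hx : Real.exp 1 ≤ x) (hxc : x ≤ c) :
    x / Real.log x ≤ c / Real.log c := by
  have hx0 : 0 < x := (Real.exp_pos 1).trans_le hx
  have hc0 : 0 < c := hx0.trans_le hxc
  have hlx : 0 < Real.log x :=
    Real.log_pos (lt_of_lt_of_le (by have := Real.exp_one_gt_d9; linarith) hx)
  have hlc : 0 < Real.log c :=
    Real.log_pos (lt_of_lt_of_le (by have := Real.exp_one_gt_d9; linarith) (hx.trans hxc))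
  have h := Real.log_div_self_antitoneOn hx (hx.trans hxc) hxc
  rw [div_le_div_iff₀ hlx hlc]
  rw [div_le_div_iff₀ hc0 hx0] at h
  linarith

/-- **`J(θ') − J(x) ≤ (θ' − x) w(x) + E²/log x`** whenever `|θ' − x| ≤ E` and `x − E ≥ e`
(tangent at `θ'` of the convex `J`, slope `θ'/log θ'` compared with `x/log x`).
[cite: MassiasNicolasRobin1988, §6 (convexity of t ↦ Li(t²))] -/
theorem liSq_sub_liSq_le {x θ' E : ℝ} (hE : |θ' - x| ≤ E) (hxE : Real.exp 1 ≤ x - E) :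
    liSq θ' - liSq x ≤ (θ' - x) * w x + E ^ 2 / Real.log x := by
  have hE0 : 0 ≤ E := (abs_nonneg _).trans hE
  have hE' := abs_le.1 hE
  have he1 : 2 < Real.exp 1 := by have := Real.exp_one_gt_d9; linarith
  have hex : Real.exp 1 ≤ x := by linarith
  have hlx : 0 < Real.log x := Real.log_pos (by linarith)
  have hθe : Real.exp 1 ≤ θ' := by linarith
  have ht := mul_div_log_le_liSq_sub hθe hex
  rcases le_or_gt x θ' with hle | hlt
  · have h1 : θ' / Real.log θ' ≤ (x + E) / Real.log x := by
      have hlθ : Real.log x ≤ Real.log θ' := Real.log_le_log (by linarith) hle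
      calc θ' / Real.log θ' ≤ θ' / Real.log x := div_le_div_of_nonneg_left (by linarith) hlx hlθ
        _ ≤ (x + E) / Real.log x := div_le_div_of_nonneg_right (by linarith) hlx.le
    have h3 : (θ' - x) * (θ' / Real.log θ') ≤ (θ' - x) * ((x + E) / Real.log x) :=
      mul_le_mul_of_nonneg_left h1 (by linarith)
    have h4 : (θ' - x) * ((x + E) / Real.log x) = (θ' - x) * w x + (θ' - x) * E / Real.log x := by
      rw [w]; ring
    have h5 : (θ' - x) * E / Real.log x ≤ E ^ 2 / Real.log x :=
      div_le_div_of_nonneg_right (by nlinarith) hlx.le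
    nlinarith [ht]
  · have h1 : (x - E) / Real.log x ≤ θ' / Real.log θ' := by
      have hm := div_log_mono hxE (show x - E ≤ θ' by linarith)
      have hl2 : Real.log (x - E) ≤ Real.log x := Real.log_le_log (by linarith) (by linarith)
      have hl3 : 0 < Real.log (x - E) := Real.log_pos (by linarith)
      calc (x - E) / Real.log x ≤ (x - E) / Real.log (x - E) :=
            div_le_div_of_nonneg_left (by linarith) hl3 hl2
        _ ≤ θ' / Real.log θ' := hm
    have h3 : (θ' - x) * (θ' / Real.log θ') ≤ (θ' - x) * ((x - E) / Real.log x) :=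
      mul_le_mul_of_nonpos_left h1 (by linarith)
    have h4 : (θ' - x) * ((x - E) / Real.log x) = (θ' - x) * w x + (x - θ') * E / Real.log x := by
      rw [w]; ring
    have h5 : (x - θ') * E / Real.log x ≤ E ^ 2 / Real.log x :=
      div_le_div_of_nonneg_right (by nlinarith) hlx.le
    nlinarith [ht]

/-- **`J(T) − J(θ) ≤ (T − θ) T/log T`** for `e ≤ θ`, `e ≤ T` (tangent at `T`).
[cite: MassiasNicolasRobin1988, §6 (convexity of t ↦ Li(t²))] -/
theorem liSq_sub_liSq_le' {T θ' : ℝ} (hT : Real.exp 1 ≤ T) (hθ : Real.exp 1 ≤ θ') :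
    liSq T - liSq θ' ≤ (T - θ') * (T / Real.log T) := by
  have := mul_div_log_le_liSq_sub hT hθ
  linarith

/-! ## §4 `∫₂ˣ (ψ(t) − t) w′(t) dt ≤ (0.05 + o(1)) x^{3/2}/log x` under RH (by parts to `ψ₁`) -/

/-- `t^{3/2} = t √t`. [folklore] -/
private theorem rpow_three_halves {t : ℝ} (ht : 0 ≤ t) : t ^ ((3:ℝ)/2) = t * Real.sqrt t := by
  rw [show ((3:ℝ)/2) = 1 + 1/2 by norm_num, Real.rpow_add' ht (by norm_num), Real.rpow_one,
    Real.sqrt_eq_rpow]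

/-- `|w″(t)| ≤ 4/(t log² t)` for `t ≥ 2`. [folklore] -/
private theorem abs_w2_le {t : ℝ} (ht : 2 ≤ t) : |w2 t| ≤ 4 / (t * Real.log t ^ 2) := by
  have hl2 : (0.6931471803:ℝ) < Real.log 2 := Real.log_two_gt_d9
  have hl : 0.6931471803 < Real.log t := hl2.trans_le (Real.log_le_log (by norm_num) ht)
  have ht0 : 0 < t := by linarith
  have hl0 : 0 < Real.log t := by linarith
  rw [w2, abs_div, abs_of_pos (by positivity : 0 < t * Real.log t ^ 3), div_le_div_iff₀ (by positivity) (by positivity)]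
  have h1 : |2 - Real.log t| ≤ 4 * Real.log t := by
    rw [abs_le]; constructor <;> linarith
  calc |2 - Real.log t| * (t * Real.log t ^ 2) ≤ 4 * Real.log t * (t * Real.log t ^ 2) :=
        mul_le_mul_of_nonneg_right h1 (by positivity)
    _ = 4 * (t * Real.log t ^ 3) := by ring

/-- `0 ≤ w′(t) ≤ 1/log t` for `t ≥ e`. [folklore] -/
private theorem w1_bounds {t : ℝ} (ht : Real.exp 1 ≤ t) : 0 ≤ w1 t ∧ w1 t ≤ 1 / Real.log t := by
  have ht0 : 0 < t := (Real.exp_pos 1).trans_le ht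
  have hl : 1 ≤ Real.log t := by rw [Real.le_log_iff_exp_le ht0]; exact ht
  rw [w1]
  refine ⟨div_nonneg (by linarith) (by positivity), ?_⟩
  rw [div_le_div_iff₀ (by positivity) (by positivity)]
  nlinarith

/-- the error weight `bnd_M(t) = 0.2 √t/log²t + 4M/(t log² t)`. [folklore] -/
private noncomputable def bnd (M t : ℝ) : ℝ :=
  0.2 * (Real.sqrt t / Real.log t ^ 2) + 4 * M / (t * Real.log t ^ 2)

/-- continuity of `bnd` at `t > 1`. [folklore] -/
private theorem continuousAt_bnd (M : ℝ) {t : ℝ} (ht : 1 < t) : ContinuousAt (bnd M) t := by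
  have ht0 : t ≠ 0 := by positivity
  have hl : Real.log t ≠ 0 := (Real.log_pos ht).ne'
  unfold bnd
  refine (continuousAt_const.mul ((Real.continuous_sqrt.continuousAt).div
    ((Real.continuousAt_log ht0).pow 2) (pow_ne_zero 2 hl))).add
    (continuousAt_const.div (continuousAt_id.mul ((Real.continuousAt_log ht0).pow 2))
      (mul_ne_zero ht0 (pow_ne_zero 2 hl)))

/-- interval integrability of `bnd` on `[a, b] ⊆ [2, ∞)`. [folklore] -/
private theorem intervalIntegrable_bnd (M : ℝ) {a b : ℝ} (ha : 2 ≤ a) (hab : a ≤ b) :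
    IntervalIntegrable (bnd M) volume a b :=
  intervalIntegrable_of_continuousAt (by linarith) hab fun t ht ↦ continuousAt_bnd M ht

/-- `0.48 ≤ log² 2`. [folklore] -/
private theorem log_two_sq : (0.48:ℝ) ≤ Real.log 2 ^ 2 := by
  have h := Real.log_two_gt_d9
  have := mul_self_le_mul_self (by norm_num : (0:ℝ) ≤ 0.6931471803) h.le
  rw [sq]; nlinarith [this]

/-- **by parts**: `∫₂ˣ (ψ − t) w′ = R(x) w′(x) − R(2) w′(2) − ∫₂ˣ R w″`, `R = ψ₁ − t²/2`
(right-derivative FTC, `ψ₁' = ψ` from the right). [cite: MontgomeryVaughan2007, (13.6)] -/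
theorem integral_psi_sub_mul_w1_eq {x : ℝ} (hx : 2 ≤ x) :
    ∫ t in (2:ℝ)..x, (ψ t - t) * w1 t
      = LiThetaRH.psiOneErr x * w1 x - LiThetaRH.psiOneErr 2 * w1 2
        - ∫ t in (2:ℝ)..x, LiThetaRH.psiOneErr t * w2 t := by
  have hcontErr : Continuous LiThetaRH.psiOneErr := by
    unfold LiThetaRH.psiOneErr; exact NicolasJ.continuous_psiOne.sub (by continuity)
  have hw1c : ContinuousOn w1 (Set.Icc 2 x) :=
    continuousOn_of_continuousAt one_lt_two fun t ht ↦ continuousAt_w1 ht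
  have hw2c : ContinuousOn w2 (Set.Icc 2 x) :=
    continuousOn_of_continuousAt one_lt_two fun t ht ↦ continuousAt_w2 ht
  have hA_int : IntervalIntegrable (fun t ↦ (ψ t - t) * w1 t) volume 2 x := by
    refine ((Chebyshev.psi_mono.intervalIntegrable).sub
      (continuous_id.intervalIntegrable _ _)).mul_continuousOn ?_
    rw [Set.uIcc_of_le hx]; exact hw1c
  have hB_int : IntervalIntegrable (fun t ↦ LiThetaRH.psiOneErr t * w2 t) volume 2 x := by
    refine (hcontErr.intervalIntegrable _ _).mul_continuousOn ?_
    rw [Set.uIcc_of_le hx]; exact hw2c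
  have hFTC : ∫ t in (2:ℝ)..x, ((ψ t - t) * w1 t + LiThetaRH.psiOneErr t * w2 t)
      = LiThetaRH.psiOneErr x * w1 x - LiThetaRH.psiOneErr 2 * w1 2 := by
    refine intervalIntegral.integral_eq_sub_of_hasDeriv_right_of_le hx
      (hcontErr.continuousOn.mul hw1c) (fun t ht ↦ ?_) (hA_int.add hB_int)
    have ht1 : 1 < t := by linarith [ht.1]
    have hE : HasDerivWithinAt LiThetaRH.psiOneErr (ψ t - t) (Set.Ioi t) t := by
      have h1 := NicolasJ.hasDerivWithinAt_psiOne t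
      have h2 : HasDerivAt (fun s : ℝ ↦ s ^ 2 / 2) (((2:ℕ):ℝ) * t ^ (2 - 1) / 2) t :=
        (hasDerivAt_pow 2 t).div_const 2
      have e2 : ((2:ℕ):ℝ) * t ^ (2 - 1) / 2 = t := by push_cast; ring
      exact h1.sub (h2.hasDerivWithinAt.congr_deriv e2)
    exact hE.mul (hasDerivAt_w1 ht1).hasDerivWithinAt
  have hsplit := intervalIntegral.integral_add hA_int hB_int
  linarith

set_option maxHeartbeats 400000 in
/-- `∫₂ˣ bnd ≤ 1.22 x√x/log²x + 8.4 M x` (split at `s = x/log²x`). [folklore] -/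
private theorem integral_bnd_le {M x : ℝ} (hM0 : 0 ≤ M) (hx : Real.exp 244 ≤ x)
    (hX₁ : Real.log x ^ 2 ≤ Real.sqrt x) :
    ∫ t in (2:ℝ)..x, bnd M t ≤ 1.22 * (x * Real.sqrt x / Real.log x ^ 2) + 8.4 * M * x := by
  have hx2 : (2:ℝ) < x := by have := Real.add_one_le_exp (244:ℝ); linarith
  have hx0 : 0 < x := by linarith
  have hlx : 244 ≤ Real.log x := by rw [Real.le_log_iff_exp_le hx0]; exact hx
  have hlx0 : 0 < Real.log x := by linarith
  have hsx : 0 < Real.sqrt x := Real.sqrt_pos.2 hx0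
  have hsx2 : Real.sqrt x * Real.sqrt x = x := Real.mul_self_sqrt hx0.le
  set s₀ : ℝ := x / Real.log x ^ 2 with hs₀
  have hs_ge : Real.sqrt x ≤ s₀ := by
    rw [hs₀, le_div_iff₀ (by positivity)]
    calc Real.sqrt x * Real.log x ^ 2 ≤ Real.sqrt x * Real.sqrt x :=
          mul_le_mul_of_nonneg_left hX₁ hsx.le
      _ = x := hsx2
  have hs_le : s₀ ≤ x := by
    rw [hs₀, div_le_iff₀ (by positivity)]
    have h1 : (1:ℝ) ≤ Real.log x ^ 2 := one_le_pow₀ (by linarith)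
    nlinarith [h1]
  have hsx16 : (2:ℝ) ≤ Real.sqrt x := by
    rw [Real.le_sqrt (by norm_num) hx0.le]; norm_num
    have := Real.add_one_le_exp (244:ℝ); linarith
  have hs2 : (2:ℝ) ≤ s₀ := hsx16.trans hs_ge
  have hs0 : 0 < s₀ := by linarith
  have hlogs : Real.log x / 2 ≤ Real.log s₀ := by
    have : Real.log (Real.sqrt x) = Real.log x / 2 := by rw [Real.log_sqrt hx0.le]
    rw [← this]; exact Real.log_le_log hsx hs_ge
  have hlogs0 : 0 < Real.log s₀ := by linarith
  have hl22 := log_two_sq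
  -- bounds for `bnd` on `[2, s₀]` and on `[s₀, x]`
  have hbnd1 : ∀ t ∈ Set.Icc 2 s₀, bnd M t ≤ 0.42 * Real.sqrt s₀ + 4.2 * M := by
    intro t ht
    have ht0 : 0 < t := by linarith [ht.1]
    have hlt2 : Real.log 2 ≤ Real.log t := Real.log_le_log (by norm_num) ht.1
    have hl20 : 0 < Real.log 2 := Real.log_pos (by norm_num)
    have hlt' : 0.48 ≤ Real.log t ^ 2 := hl22.trans (pow_le_pow_left₀ hl20.le hlt2 2)
    have e1 : Real.sqrt t / Real.log t ^ 2 ≤ Real.sqrt s₀ / 0.48 := by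
      rw [div_le_div_iff₀ (by positivity) (by norm_num)]
      calc Real.sqrt t * 0.48 ≤ Real.sqrt s₀ * 0.48 :=
            mul_le_mul_of_nonneg_right (Real.sqrt_le_sqrt ht.2) (by norm_num)
        _ ≤ Real.sqrt s₀ * Real.log t ^ 2 := mul_le_mul_of_nonneg_left hlt' (Real.sqrt_nonneg _)
    have e2 : 4 * M / (t * Real.log t ^ 2) ≤ 4 * M / (2 * 0.48) := by
      apply div_le_div_of_nonneg_left (by positivity) (by norm_num)
      exact mul_le_mul ht.1 hlt' (by norm_num) ht0.le
    have e3 : 0.2 * (Real.sqrt s₀ / 0.48) ≤ 0.42 * Real.sqrt s₀ := by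
      have := Real.sqrt_nonneg s₀; rw [mul_div_assoc']; rw [div_le_iff₀ (by norm_num)]; nlinarith
    have e4 : 4 * M / (2 * 0.48) ≤ 4.2 * M := by
      rw [div_le_iff₀ (by norm_num)]; nlinarith
    unfold bnd
    linarith [mul_le_mul_of_nonneg_left e1 (by norm_num : (0:ℝ) ≤ 0.2)]
  have hbnd2 : ∀ t ∈ Set.Icc s₀ x, bnd M t ≤ 0.8 * (Real.sqrt x / Real.log x ^ 2) + 4.2 * M := by
    intro t ht
    have ht2 : 2 ≤ t := hs2.trans ht.1
    have ht0 : 0 < t := by linarith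
    have hlt : Real.log s₀ ≤ Real.log t := Real.log_le_log hs0 ht.1
    have hlt0 : 0 < Real.log t := hlogs0.trans_le hlt
    have hlt1 : Real.log x / 2 ≤ Real.log t := hlogs.trans hlt
    have hlt' : Real.log x ^ 2 / 4 ≤ Real.log t ^ 2 := by
      have := pow_le_pow_left₀ (by positivity) hlt1 2
      calc Real.log x ^ 2 / 4 = (Real.log x / 2) ^ 2 := by ring
        _ ≤ Real.log t ^ 2 := this
    have hl20 : 0 < Real.log 2 := Real.log_pos (by norm_num)
    have hlt2' : 0.48 ≤ Real.log t ^ 2 :=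
      hl22.trans (pow_le_pow_left₀ hl20.le (Real.log_le_log (by norm_num) ht2) 2)
    have e1 : Real.sqrt t / Real.log t ^ 2 ≤ Real.sqrt x / (Real.log x ^ 2 / 4) := by
      rw [div_le_div_iff₀ (by positivity) (by positivity)]
      calc Real.sqrt t * (Real.log x ^ 2 / 4) ≤ Real.sqrt x * (Real.log x ^ 2 / 4) :=
            mul_le_mul_of_nonneg_right (Real.sqrt_le_sqrt ht.2) (by positivity)
        _ ≤ Real.sqrt x * Real.log t ^ 2 := mul_le_mul_of_nonneg_left hlt' hsx.le
    have e2 : 4 * M / (t * Real.log t ^ 2) ≤ 4 * M / (2 * 0.48) := by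
      apply div_le_div_of_nonneg_left (by positivity) (by norm_num)
      exact mul_le_mul ht2 hlt2' (by norm_num) ht0.le
    have e3 : Real.sqrt x / (Real.log x ^ 2 / 4) = 4 * (Real.sqrt x / Real.log x ^ 2) := by
      field_simp
    have e4 : 4 * M / (2 * 0.48) ≤ 4.2 * M := by
      rw [div_le_iff₀ (by norm_num)]; nlinarith
    unfold bnd
    rw [e3] at e1
    linarith [mul_le_mul_of_nonneg_left e1 (by norm_num : (0:ℝ) ≤ 0.2)]
  -- integrate
  have hI1 : ∫ t in (2:ℝ)..s₀, bnd M t ≤ (s₀ - 2) * (0.42 * Real.sqrt s₀ + 4.2 * M) := by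
    have := intervalIntegral.integral_mono_on hs2 (intervalIntegrable_bnd M le_rfl hs2)
      intervalIntegrable_const hbnd1
    rwa [intervalIntegral.integral_const, smul_eq_mul] at this
  have hI2 : ∫ t in s₀..x, bnd M t ≤ (x - s₀) * (0.8 * (Real.sqrt x / Real.log x ^ 2) + 4.2 * M) := by
    have := intervalIntegral.integral_mono_on hs_le (intervalIntegrable_bnd M hs2 hs_le)
      intervalIntegrable_const hbnd2
    rwa [intervalIntegral.integral_const, smul_eq_mul] at this
  have hIadd : ∫ t in (2:ℝ)..x, bnd M t = (∫ t in (2:ℝ)..s₀, bnd M t) + ∫ t in s₀..x, bnd M t :=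
    (intervalIntegral.integral_add_adjacent_intervals (intervalIntegrable_bnd M le_rfl hs2)
      (intervalIntegrable_bnd M hs2 hs_le)).symm
  have hss : Real.sqrt s₀ ≤ Real.sqrt x := Real.sqrt_le_sqrt hs_le
  have hQ : x * Real.sqrt x / Real.log x ^ 2 = s₀ * Real.sqrt x := by rw [hs₀]; ring
  have e1 : (s₀ - 2) * (0.42 * Real.sqrt s₀ + 4.2 * M)
      ≤ 0.42 * (s₀ * Real.sqrt x) + 4.2 * M * x := by
    have h0 : 0 ≤ 0.42 * Real.sqrt s₀ + 4.2 * M := by positivity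
    have h1 : (s₀ - 2) * (0.42 * Real.sqrt s₀ + 4.2 * M) ≤ s₀ * (0.42 * Real.sqrt s₀ + 4.2 * M) := by
      nlinarith
    have h2 : s₀ * (0.42 * Real.sqrt s₀) ≤ s₀ * (0.42 * Real.sqrt x) := by
      exact mul_le_mul_of_nonneg_left (by nlinarith) hs0.le
    have h3 : s₀ * (4.2 * M) ≤ 4.2 * M * x := by nlinarith
    nlinarith
  have e2 : (x - s₀) * (0.8 * (Real.sqrt x / Real.log x ^ 2) + 4.2 * M)
      ≤ 0.8 * (s₀ * Real.sqrt x) + 4.2 * M * x := by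
    have h0 : 0 ≤ 0.8 * (Real.sqrt x / Real.log x ^ 2) + 4.2 * M := by positivity
    have h1 : (x - s₀) * (0.8 * (Real.sqrt x / Real.log x ^ 2) + 4.2 * M)
        ≤ x * (0.8 * (Real.sqrt x / Real.log x ^ 2) + 4.2 * M) := by nlinarith
    have h2 : x * (0.8 * (Real.sqrt x / Real.log x ^ 2)) = 0.8 * (s₀ * Real.sqrt x) := by
      rw [hs₀]; field_simp
    linarith
  rw [hIadd, hQ]
  linarith

/-- **RH ⟹ `∫₂ˣ (ψ(t) − t) w′(t) dt ≤ 0.06 · x^{3/2}/log x`** for large `x` (integration by parts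
to `ψ₁` and MV (13.8): `|ψ₁(t) − t²/2| ≤ 0.05 t^{3/2}` under RH).
[cite: MontgomeryVaughan2007, (13.6)–(13.8)] -/
theorem integral_psi_sub_mul_w1_le (hRH : RiemannHypothesis) :
    ∃ X : ℝ, 2 ≤ X ∧ ∀ x : ℝ, X ≤ x →
      ∫ t in (2:ℝ)..x, (ψ t - t) * w1 t ≤ 0.06 * (x * Real.sqrt x / Real.log x) := by
  obtain ⟨T, hT2, hT⟩ := LiThetaRH.exists_abs_psiOneErr_le_of_RH hRH
  have hcontErr : Continuous LiThetaRH.psiOneErr := by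
    unfold LiThetaRH.psiOneErr; exact NicolasJ.continuous_psiOne.sub (by continuity)
  obtain ⟨M, hM⟩ : ∃ M : ℝ, ∀ t ∈ Set.Icc 2 T, |LiThetaRH.psiOneErr t| ≤ M := by
    obtain ⟨M, hM⟩ := isCompact_Icc.exists_bound_of_continuousOn hcontErr.continuousOn
    exact ⟨M, fun t ht ↦ by simpa [Real.norm_eq_abs] using hM t ht⟩
  have hM0 : 0 ≤ M := (abs_nonneg _).trans (hM 2 ⟨le_rfl, hT2⟩)
  have hR : ∀ t : ℝ, 2 ≤ t → |LiThetaRH.psiOneErr t| ≤ 0.05 * (t * Real.sqrt t) + M := by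
    intro t ht
    have h0 : 0 ≤ 0.05 * (t * Real.sqrt t) := by positivity
    rcases le_or_gt T t with hTt | hTt
    · have := hT t hTt; rw [rpow_three_halves (by linarith)] at this; linarith
    · have := hM t ⟨ht, hTt.le⟩; linarith
  set K : ℝ := 8.4 * M + 2 + |LiThetaRH.psiOneErr 2 * w1 2| with hK
  have hK0 : 0 < K := by rw [hK]; positivity
  obtain ⟨X₁, hX₁⟩ := exists_log_pow_le 2 (s := 1/2) (ε := 1) (by norm_num) one_pos
  obtain ⟨X₂, hX₂⟩ := exists_log_pow_le 1 (s := 1/2) (ε := 0.005 / K) (by norm_num) (by positivity)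
  have h244 : (2:ℝ) ≤ Real.exp 244 := by have := Real.add_one_le_exp (244:ℝ); linarith
  refine ⟨max (max X₁ X₂) (max (Real.exp 244) T),
    h244.trans ((le_max_left _ _).trans (le_max_right _ _)), fun x hx ↦ ?_⟩
  have hx244 : Real.exp 244 ≤ x := ((le_max_left _ _).trans (le_max_right _ _)).trans hx
  have hxT : T ≤ x := ((le_max_right _ _).trans (le_max_right _ _)).trans hx
  have hxX₁ : X₁ ≤ x := ((le_max_left _ _).trans (le_max_left _ _)).trans hx
  have hxX₂ : X₂ ≤ x := ((le_max_right _ _).trans (le_max_left _ _)).trans hx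
  have hx2 : (2:ℝ) < x := by have := Real.add_one_le_exp (244:ℝ); linarith
  have hx0 : 0 < x := by linarith
  have hlx : 244 ≤ Real.log x := by rw [Real.le_log_iff_exp_le hx0]; exact hx244
  have hlx0 : 0 < Real.log x := by linarith
  have hsx : 0 < Real.sqrt x := Real.sqrt_pos.2 hx0
  have hsqrt_eq : x ^ ((1:ℝ)/2) = Real.sqrt x := (Real.sqrt_eq_rpow x).symm
  have hex : Real.exp 1 ≤ x := by
    have := Real.exp_le_exp.2 (show (1:ℝ) ≤ 244 by norm_num); linarith
  -- main term
  have hGx : LiThetaRH.psiOneErr x * w1 x ≤ 0.05 * (x * Real.sqrt x / Real.log x) := by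
    have hw := w1_bounds hex
    have h2 := hT x hxT
    rw [rpow_three_halves hx0.le] at h2
    have h3 : |LiThetaRH.psiOneErr x| * w1 x ≤ (0.05 * (x * Real.sqrt x)) * (1 / Real.log x) :=
      mul_le_mul h2 hw.2 hw.1 (by positivity)
    calc LiThetaRH.psiOneErr x * w1 x ≤ |LiThetaRH.psiOneErr x| * w1 x :=
          mul_le_mul_of_nonneg_right (le_abs_self _) hw.1
      _ ≤ (0.05 * (x * Real.sqrt x)) * (1 / Real.log x) := h3
      _ = 0.05 * (x * Real.sqrt x / Real.log x) := by ring
  -- error integral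
  have hBle : ∀ t ∈ Set.Icc 2 x, |LiThetaRH.psiOneErr t * w2 t| ≤ bnd M t := by
    intro t ht
    have ht0 : 0 < t := by linarith [ht.1]
    have hlt : 0 < Real.log t := Real.log_pos (by linarith [ht.1])
    rw [abs_mul]
    calc |LiThetaRH.psiOneErr t| * |w2 t|
        ≤ (0.05 * (t * Real.sqrt t) + M) * (4 / (t * Real.log t ^ 2)) :=
          mul_le_mul (hR t ht.1) (abs_w2_le ht.1) (abs_nonneg _) (by positivity)
      _ = bnd M t := by unfold bnd; field_simp; ring
  have hB_int : IntervalIntegrable (fun t ↦ LiThetaRH.psiOneErr t * w2 t) volume 2 x := by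
    refine (hcontErr.intervalIntegrable _ _).mul_continuousOn ?_
    rw [Set.uIcc_of_le hx2.le]
    exact continuousOn_of_continuousAt one_lt_two fun t ht ↦ continuousAt_w2 ht
  have hBint_le : -(∫ t in (2:ℝ)..x, LiThetaRH.psiOneErr t * w2 t) ≤ ∫ t in (2:ℝ)..x, bnd M t := by
    have := intervalIntegral.integral_mono_on hx2.le ((intervalIntegrable_bnd M le_rfl hx2.le).neg)
      hB_int (fun t ht ↦ (neg_abs_le _).trans' (neg_le_neg (hBle t ht)))
    simp only [Pi.neg_apply, intervalIntegral.integral_neg] at this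
    linarith
  have hX₁' := hX₁ x hxX₁
  rw [hsqrt_eq, one_mul] at hX₁'
  have hbnd := integral_bnd_le hM0 hx244 hX₁'
  -- absorb the lower-order terms
  have a1 : 1.22 * (x * Real.sqrt x / Real.log x ^ 2) ≤ 0.005 * (x * Real.sqrt x / Real.log x) := by
    have hq : x * Real.sqrt x / Real.log x ^ 2 = (x * Real.sqrt x / Real.log x) / Real.log x := by
      field_simp
    rw [hq, mul_div_assoc', div_le_iff₀ hlx0]
    have h0 : 0 < x * Real.sqrt x / Real.log x := by positivity
    nlinarith
  have a2 : K * x ≤ 0.005 * (x * Real.sqrt x / Real.log x) := by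
    have h := hX₂ x hxX₂
    rw [pow_one, hsqrt_eq] at h
    have h' : K * Real.log x ≤ 0.005 * Real.sqrt x := by
      have := mul_le_mul_of_nonneg_left h hK0.le
      rwa [← mul_assoc, mul_div_cancel₀ _ hK0.ne'] at this
    rw [mul_div_assoc', le_div_iff₀ hlx0]
    nlinarith
  have hG2 : -(LiThetaRH.psiOneErr 2 * w1 2) ≤ |LiThetaRH.psiOneErr 2 * w1 2| * x := by
    have h1 : -(LiThetaRH.psiOneErr 2 * w1 2) ≤ |LiThetaRH.psiOneErr 2 * w1 2| := neg_le_abs _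
    exact h1.trans (le_mul_of_one_le_right (abs_nonneg _) (by linarith))
  have hKx : 8.4 * M * x + |LiThetaRH.psiOneErr 2 * w1 2| * x ≤ K * x := by
    rw [hK]; nlinarith
  rw [integral_psi_sub_mul_w1_eq hx2.le]
  linarith [hGx, hBint_le, hbnd, a1, a2, hG2, hKx]


/-! ## §5 `∫₂ˣ (ψ − θ) w′ ≥ 0.655 x^{3/2}/log x` under RH -/

/-- RH ⟹ `|θ(u) − u| ≤ 0.001 u` for large `u` (von Koch: `θ(u) = u + O(√u log² u)`).
[cite: Koch1901, Théorème (MV Thm. 13.1)] -/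
private theorem exists_abs_theta_sub_le_small (hRH : RiemannHypothesis) :
    ∃ U : ℝ, 599 ≤ U ∧ ∀ u : ℝ, U ≤ u → |θ u - u| ≤ 0.001 * u := by
  obtain ⟨K, X₀, hK0, hX₀3, hK⟩ := LiThetaRH.exists_abs_theta_sub_le_of_RH hRH
  obtain ⟨X, hX⟩ := exists_log_pow_le 2 (s := 1/2) (ε := 0.001 / K) (by norm_num) (by positivity)
  refine ⟨max (max X X₀) 599, le_max_right _ _, fun u hu ↦ ?_⟩
  have hu0 : 0 < u := by linarith [le_max_right (max X X₀) 599]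
  have h1 := hK u (((le_max_right _ _).trans (le_max_left _ _)).trans hu)
  have h2 := hX u (((le_max_left _ _).trans (le_max_left _ _)).trans hu)
  rw [← Real.sqrt_eq_rpow] at h2
  calc |θ u - u| ≤ K * Real.sqrt u * Real.log u ^ 2 := h1
    _ ≤ K * Real.sqrt u * (0.001 / K * Real.sqrt u) := mul_le_mul_of_nonneg_left h2 (by positivity)
    _ = 0.001 * (Real.sqrt u * Real.sqrt u) := by field_simp
    _ = 0.001 * u := by rw [Real.mul_self_sqrt hu0.le]

/-- `∫_a^b √t dt = (2/3)(b√b − a√a)` for `0 < a ≤ b`. [folklore] -/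
private theorem integral_sqrt_eq {a b : ℝ} (ha : 0 < a) (hab : a ≤ b) :
    ∫ t in a..b, Real.sqrt t = 2 / 3 * (b * Real.sqrt b) - 2 / 3 * (a * Real.sqrt a) := by
  have h : ∀ t ∈ Set.uIcc a b, HasDerivAt (fun t : ℝ ↦ 2 / 3 * (t * Real.sqrt t)) (Real.sqrt t) t := by
    intro t ht
    rw [Set.uIcc_of_le hab] at ht
    have ht0 : 0 < t := by linarith [ht.1]
    have hst : 0 < Real.sqrt t := Real.sqrt_pos.2 ht0
    have h1 := ((hasDerivAt_id' t).mul (Real.hasDerivAt_sqrt ht0.ne')).const_mul (2 / 3 : ℝ)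
    have e : (2 / 3 : ℝ) * (1 * Real.sqrt t + t * (1 / (2 * Real.sqrt t))) = Real.sqrt t := by
      have := Real.mul_self_sqrt ht0.le
      field_simp
      nlinarith [this]
    exact h1.congr_deriv e
  rw [intervalIntegral.integral_eq_sub_of_hasDerivAt h
    (Real.continuous_sqrt.intervalIntegrable _ _)]

/-- **RH ⟹ `∫₂ˣ (ψ(t) − θ(t)) w′(t) dt ≥ 0.655 · x^{3/2}/log x`** for large `x`
(`ψ − θ ≥ θ(√t) = √t + O(t^{1/4} log² t)` by von Koch's RH bound, `w′ ≥ (1 − 1/log t)/log t`).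
[cite: MassiasNicolasRobin1988, §6 and Lemme B] -/
theorem integral_psi_sub_theta_mul_w1_ge (hRH : RiemannHypothesis) :
    ∃ X : ℝ, 2 ≤ X ∧ ∀ x : ℝ, X ≤ x →
      0.655 * (x * Real.sqrt x / Real.log x) ≤ ∫ t in (2:ℝ)..x, (ψ t - θ t) * w1 t := by
  obtain ⟨U, hU599, hU⟩ := exists_abs_theta_sub_le_small hRH
  set X₂ : ℝ := max (U ^ 2) (Real.exp 1000) with hX₂
  have hX₂e : Real.exp 1000 ≤ X₂ := le_max_right _ _
  have hX₂2 : (2:ℝ) < X₂ := by have := Real.add_one_le_exp (1000:ℝ); linarith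
  have hX₂0 : 0 < X₂ := by linarith
  -- thresholds for the absorption
  set C₂ : ℝ := 5 * X₂ with hC₂
  obtain ⟨X₃, hX₃⟩ := exists_log_pow_le 1 (s := 1) (ε := 0.005 / C₂) one_pos (by positivity)
  refine ⟨max (max X₂ X₃) (200 * (X₂ * Real.sqrt X₂) + 1), by
      have : X₂ ≤ max (max X₂ X₃) (200 * (X₂ * Real.sqrt X₂) + 1) := (le_max_left _ _).trans (le_max_left _ _)
      linarith, fun x hx ↦ ?_⟩
  have hxX₂ : X₂ ≤ x := ((le_max_left _ _).trans (le_max_left _ _)).trans hx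
  have hxX₃ : X₃ ≤ x := ((le_max_right _ _).trans (le_max_left _ _)).trans hx
  have hxC₁ : 200 * (X₂ * Real.sqrt X₂) + 1 ≤ x := (le_max_right _ _).trans hx
  have hx2 : (2:ℝ) < x := by linarith
  have hx0 : 0 < x := by linarith
  have hlx : 1000 ≤ Real.log x := by
    rw [Real.le_log_iff_exp_le hx0]; exact hX₂e.trans hxX₂
  have hlx0 : 0 < Real.log x := by linarith
  have hsx : 0 < Real.sqrt x := Real.sqrt_pos.2 hx0
  -- the integrand
  set g : ℝ → ℝ := fun t ↦ (ψ t - θ t) * w1 t with hg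
  have hw1c : ∀ a b : ℝ, 2 ≤ a → ContinuousOn w1 (Set.Icc a b) := fun a b ha ↦
    continuousOn_of_continuousAt (by linarith) fun t ht ↦ continuousAt_w1 ht
  have hg_int : ∀ a b : ℝ, 2 ≤ a → a ≤ b → IntervalIntegrable g volume a b := by
    intro a b ha hab
    refine ((Chebyshev.psi_mono.intervalIntegrable).sub
      (Chebyshev.theta_mono.intervalIntegrable)).mul_continuousOn ?_
    rw [Set.uIcc_of_le hab]; exact hw1c a b ha
  -- (i) `g ≥ −5` on `[2, X₂]`
  have hl2 : (0.6931471803:ℝ) < Real.log 2 := Real.log_two_gt_d9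
  have hg_lb : ∀ t ∈ Set.Icc 2 X₂, (-5:ℝ) ≤ g t := by
    intro t ht
    have ht0 : 0 < t := by linarith [ht.1]
    have hpt : 0 ≤ ψ t - θ t := by linarith [Chebyshev.theta_le_psi t]
    rcases le_or_gt (Real.exp 1) t with hte | hte
    · have := (w1_bounds hte).1
      show (-5:ℝ) ≤ (ψ t - θ t) * w1 t
      nlinarith
    · -- `2 ≤ t < e`: `0 ≤ ψ − θ ≤ 4`, `−1 ≤ w′ ≤ 0`
      have hlt1 : Real.log t < 1 := by
        rw [Real.log_lt_iff_lt_exp ht0]; exact hte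
      have hlt2 : 0.6931471803 < Real.log t := hl2.trans_le (Real.log_le_log (by norm_num) ht.1)
      have hst : Real.sqrt t ≤ 2 := by
        rw [Real.sqrt_le_left (by norm_num)]
        have := Real.exp_one_lt_d9; nlinarith
      have h1 : ψ t - θ t ≤ 4 := by
        have := Chebyshev.psi_sub_theta_le (show (1:ℝ) ≤ t by linarith [ht.1])
        nlinarith [Real.sqrt_nonneg t]
      have h2 : -1 ≤ w1 t := by
        rw [w1, le_div_iff₀ (by positivity)]; nlinarith
      have h3 : w1 t ≤ 0 := by
        rw [w1]; exact div_nonpos_of_nonpos_of_nonneg (by linarith) (by positivity)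
      show (-5:ℝ) ≤ (ψ t - θ t) * w1 t
      nlinarith
  have hI1 : -5 * (X₂ - 2) ≤ ∫ t in (2:ℝ)..X₂, g t := by
    have := intervalIntegral.integral_mono_on hX₂2.le intervalIntegrable_const
      (hg_int 2 X₂ le_rfl hX₂2.le) hg_lb
    rw [intervalIntegral.integral_const, smul_eq_mul] at this
    linarith
  -- (ii) `g ≥ 0.998 √t / log x` on `[X₂, x]`
  have hg_main : ∀ t ∈ Set.Icc X₂ x, 0.998 * (Real.sqrt t / Real.log x) ≤ g t := by
    intro t ht
    have htX : X₂ ≤ t := ht.1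
    have ht0 : 0 < t := by linarith
    have hte : Real.exp 1000 ≤ t := hX₂e.trans htX
    have hlt : 1000 ≤ Real.log t := by rw [Real.le_log_iff_exp_le ht0]; exact hte
    have hlt0 : 0 < Real.log t := by linarith
    have hltx : Real.log t ≤ Real.log x := Real.log_le_log ht0 ht.2
    -- `√t ≥ U`
    have hst : U ≤ Real.sqrt t := by
      rw [Real.le_sqrt (by linarith) ht0.le]; exact (le_max_left _ _).trans htX
    have hst0 : 0 < Real.sqrt t := Real.sqrt_pos.2 ht0
    -- `ψ − θ ≥ θ(√t) ≥ 0.999 √t`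
    have hpt : 0.999 * Real.sqrt t ≤ ψ t - θ t := by
      have h1 := Chebyshev.psi_sub_theta_ge_psi_add_psi_add_psi ht0.le
      have h2 : ψ (t ^ (2:ℝ)⁻¹) = ψ (Real.sqrt t) := by
        rw [Real.sqrt_eq_rpow, show ((2:ℝ)⁻¹) = 1 / 2 by norm_num]
      have h3 := Chebyshev.theta_le_psi (Real.sqrt t)
      have h4 := hU (Real.sqrt t) hst
      have h6 := (abs_le.1 h4).1
      have h7 := Chebyshev.psi_nonneg (t ^ (3:ℝ)⁻¹)
      have h8 := Chebyshev.psi_nonneg (t ^ (7:ℝ)⁻¹)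
      rw [h2] at h1
      linarith
    -- `w′ ≥ 0.999/log x`
    have hw : 0.999 / Real.log x ≤ w1 t := by
      have e1 : w1 t = (1 - 1 / Real.log t) / Real.log t := by
        rw [w1]; field_simp
      have e2 : 0.999 ≤ 1 - 1 / Real.log t := by
        rw [one_sub_div hlt0.ne', le_div_iff₀ hlt0]; nlinarith
      rw [e1]
      calc 0.999 / Real.log x ≤ 0.999 / Real.log t :=
            div_le_div_of_nonneg_left (by norm_num) hlt0 hltx
        _ ≤ (1 - 1 / Real.log t) / Real.log t := div_le_div_of_nonneg_right e2 hlt0.le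
    have hw0 : 0 ≤ 0.999 / Real.log x := by positivity
    show 0.998 * (Real.sqrt t / Real.log x) ≤ (ψ t - θ t) * w1 t
    calc 0.998 * (Real.sqrt t / Real.log x) ≤ (0.999 * Real.sqrt t) * (0.999 / Real.log x) := by
          rw [show (0.999 * Real.sqrt t) * (0.999 / Real.log x)
            = (0.999 * 0.999) * (Real.sqrt t / Real.log x) by ring]
          exact mul_le_mul_of_nonneg_right (by norm_num) (by positivity)
      _ ≤ (ψ t - θ t) * w1 t := mul_le_mul hpt hw hw0 (by linarith)
  have hI2 : 0.998 / Real.log x * (2 / 3 * (x * Real.sqrt x) - 2 / 3 * (X₂ * Real.sqrt X₂))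
      ≤ ∫ t in X₂..x, g t := by
    have hsq_int : IntervalIntegrable (fun t ↦ 0.998 * (Real.sqrt t / Real.log x)) volume X₂ x :=
      (continuous_const.mul (Real.continuous_sqrt.div_const _)).intervalIntegrable _ _
    have := intervalIntegral.integral_mono_on hxX₂ hsq_int (hg_int X₂ x hX₂2.le hxX₂) hg_main
    have e : ∫ t in X₂..x, 0.998 * (Real.sqrt t / Real.log x)
        = 0.998 / Real.log x * (2 / 3 * (x * Real.sqrt x) - 2 / 3 * (X₂ * Real.sqrt X₂)) := by
      rw [← integral_sqrt_eq hX₂0 hxX₂, ← intervalIntegral.integral_const_mul]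
      refine intervalIntegral.integral_congr fun t _ ↦ ?_
      show _ = _ * _; ring
    linarith
  have hIadd : ∫ t in (2:ℝ)..x, g t = (∫ t in (2:ℝ)..X₂, g t) + ∫ t in X₂..x, g t :=
    (intervalIntegral.integral_add_adjacent_intervals (hg_int 2 X₂ le_rfl hX₂2.le)
      (hg_int X₂ x hX₂2.le hxX₂)).symm
  -- absorb
  have hQ0 : 0 < x * Real.sqrt x / Real.log x := by positivity
  have a1 : C₂ ≤ 0.005 * (x * Real.sqrt x / Real.log x) := by
    have h := hX₃ x hxX₃
    rw [pow_one, Real.rpow_one] at h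
    have hC0 : 0 < C₂ := by rw [hC₂]; positivity
    have h' : C₂ * Real.log x ≤ 0.005 * x := by
      have := mul_le_mul_of_nonneg_left h hC0.le
      rwa [← mul_assoc, mul_div_cancel₀ _ hC0.ne'] at this
    have hx1 : x ≤ x * Real.sqrt x := by
      have : 1 ≤ Real.sqrt x := by
        rw [Real.le_sqrt (by norm_num) hx0.le]; linarith
      nlinarith
    rw [mul_div_assoc', le_div_iff₀ hlx0]
    nlinarith
  have a2 : 0.998 / Real.log x * (2 / 3 * (X₂ * Real.sqrt X₂)) ≤ 0.005 * (x * Real.sqrt x / Real.log x) := by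
    rw [div_mul_eq_mul_div, mul_div_assoc', div_le_div_iff_of_pos_right hlx0]
    have hx1 : x ≤ x * Real.sqrt x := by
      have : 1 ≤ Real.sqrt x := by
        rw [Real.le_sqrt (by norm_num) hx0.le]; linarith
      nlinarith
    have : 0 ≤ X₂ * Real.sqrt X₂ := by positivity
    nlinarith
  have e3 : 0.998 / Real.log x * (2 / 3 * (x * Real.sqrt x)) = (0.998 * 2 / 3) * (x * Real.sqrt x / Real.log x) := by
    ring
  rw [hIadd]
  nlinarith [hI1, hI2, a1, a2, e3, hQ0]


/-! ## §6 The layer `A₂(x)`: `{p : p² ≤ v(x)²} ⊆ A₂(x) ⊆ {p ≤ √(0.505 x)}` -/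

/-- `e^{140} ≥ 320000`. [folklore] -/
private theorem exp_140_ge : (320000:ℝ) ≤ Real.exp 140 := by
  have h1 : Real.exp 140 = Real.exp 20 ^ 7 := by
    rw [← Real.exp_nat_mul]; norm_num
  have h2 : (21:ℝ) ≤ Real.exp 20 := by have := Real.add_one_le_exp (20:ℝ); linarith
  have h3 : (21:ℝ) ^ 7 ≤ Real.exp 20 ^ 7 := pow_le_pow_left₀ (by norm_num) h2 7
  rw [h1]; linarith [show (320000:ℝ) ≤ 21 ^ 7 by norm_num]

/-- **`A₂(x) ⊆ {p ≤ √(0.505 x)}`** for `x ≥ e^{140}`: a prime `p ≤ x` with `p² − p ≤ ρ(x) log p`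
has `p ≤ √(0.505x)`. [cite: MassiasNicolasRobin1988, §4 (7) (x₂ ~ √(x₁/2))] -/
theorem le_sqrt_of_inA2 {x : ℝ} (hx : Real.exp 140 ≤ x) {p : ℕ} (hp : p.Prime) (hpx : (p:ℝ) ≤ x)
    (hA : (p:ℝ) ^ 2 - p ≤ rho x * Real.log p) : (p:ℝ) ≤ Real.sqrt (0.505 * x) := by
  have hx3 : (320000:ℝ) ≤ x := exp_140_ge.trans hx
  have hx0 : 0 < x := by linarith
  have hlx : 140 ≤ Real.log x := by rw [Real.le_log_iff_exp_le hx0]; exact hx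
  have hlx0 : 0 < Real.log x := by linarith
  have hp2 : (2:ℝ) ≤ p := by exact_mod_cast hp.two_le
  have hρ0 : 0 ≤ rho x := by rw [rho]; positivity
  have hlp : Real.log p ≤ Real.log x := Real.log_le_log (by linarith) hpx
  have h1 : rho x * Real.log p ≤ x := by
    calc rho x * Real.log p ≤ rho x * Real.log x := mul_le_mul_of_nonneg_left hlp hρ0
      _ = x := by rw [rho, div_mul_cancel₀ _ hlx0.ne']
  have h2 : (p:ℝ) ^ 2 ≤ 2 * x := by nlinarith
  have h3 : Real.log p ≤ (Real.log 2 + Real.log x) / 2 := by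
    have e1 : Real.log ((p:ℝ) ^ 2) = 2 * Real.log p := by rw [Real.log_pow]; push_cast; ring
    have e2 : Real.log ((p:ℝ) ^ 2) ≤ Real.log (2 * x) := Real.log_le_log (by positivity) h2
    rw [Real.log_mul (by norm_num) hx0.ne'] at e2
    linarith
  have h4 : rho x * Real.log p ≤ x / 2 + x * Real.log 2 / (2 * Real.log x) := by
    calc rho x * Real.log p ≤ rho x * ((Real.log 2 + Real.log x) / 2) :=
          mul_le_mul_of_nonneg_left h3 hρ0
      _ = x / 2 + x * Real.log 2 / (2 * Real.log x) := by rw [rho]; field_simp; ring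
  have h5 : x * Real.log 2 / (2 * Real.log x) ≤ 0.0025 * x := by
    rw [div_le_iff₀ (by positivity)]; have := Real.log_two_lt_d9; nlinarith
  have h6 : (p:ℝ) ≤ 0.0025 * x := by
    have e1 : (p:ℝ) ≤ Real.sqrt (2 * x) := Real.le_sqrt_of_sq_le h2
    have e2 : Real.sqrt (2 * x) ≤ 0.0025 * x := by
      rw [Real.sqrt_le_iff]; constructor
      · positivity
      · nlinarith
    exact e1.trans e2
  apply Real.le_sqrt_of_sq_le
  nlinarith

/-- `v(x)² = (x/2)(1 − (1 + log log x)/log x)`. [cite: MassiasNicolasRobin1988, §4 (7)] -/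
noncomputable def vSq (x : ℝ) : ℝ := x / 2 * (1 - (1 + Real.log (Real.log x)) / Real.log x)

/-- **`{p : p² ≤ v(x)²} ⊆ A₂(x)`** for `x ≥ e²`. [cite: MassiasNicolasRobin1988, §4 (7)] -/
theorem inA2_of_sq_le_vSq {x : ℝ} (hx : Real.exp 2 ≤ x) {p : ℕ} (hp : p.Prime)
    (hpv : (p:ℝ) ^ 2 ≤ vSq x) : (p:ℝ) ^ 2 - p ≤ rho x * Real.log p := by
  have hx0 : 0 < x := (Real.exp_pos 2).trans_le hx
  have hlx : 2 ≤ Real.log x := by rw [Real.le_log_iff_exp_le hx0]; exact hx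
  have hlx0 : 0 < Real.log x := by linarith
  have hρ0 : 0 < rho x := by rw [rho]; positivity
  have hp2 : (2:ℝ) ≤ p := by exact_mod_cast hp.two_le
  have hp0 : (0:ℝ) ≤ p := by linarith
  have hl2p : Real.log 2 ≤ Real.log p := Real.log_le_log (by norm_num) hp2
  by_cases hc : (p:ℝ) ^ 2 ≤ rho x * Real.log 2
  · calc (p:ℝ) ^ 2 - p ≤ (p:ℝ) ^ 2 := by linarith
      _ ≤ rho x * Real.log 2 := hc
      _ ≤ rho x * Real.log p := mul_le_mul_of_nonneg_left hl2p hρ0.le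
  · push Not at hc
    have hl20 : 0 < Real.log 2 := Real.log_pos one_lt_two
    have h1 : Real.log (rho x * Real.log 2) < 2 * Real.log p := by
      have e1 : 2 * Real.log p = Real.log ((p:ℝ) ^ 2) := by rw [Real.log_pow]; push_cast; ring
      rw [e1]; exact Real.log_lt_log (by positivity) hc
    have h2 : Real.log (rho x * Real.log 2)
        = Real.log x - Real.log (Real.log x) + Real.log (Real.log 2) := by
      rw [rho, Real.log_mul (by positivity) hl20.ne', Real.log_div hx0.ne' hlx0.ne']
    have h3 : -1 ≤ Real.log (Real.log 2) := by
      rw [Real.le_log_iff_exp_le hl20]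
      have := Real.exp_neg_one_lt_d9; have := Real.log_two_gt_d9; linarith
    have h4 : vSq x ≤ rho x * Real.log p := by
      have e : vSq x = rho x * ((Real.log x - 1 - Real.log (Real.log x)) / 2) := by
        rw [vSq, rho]; field_simp; ring
      rw [e]; exact mul_le_mul_of_nonneg_left (by linarith) hρ0.le
    linarith

/-- **`T(x) − θ(x) ≤ θ(√(0.505x))`** for `x ≥ e^{140}`. [cite: MassiasNicolasRobin1988, §4 (6)–(7)] -/
theorem bigT_sub_theta_le {x : ℝ} (hx : Real.exp 140 ≤ x) :
    bigT x - θ x ≤ θ (Real.sqrt (0.505 * x)) := by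
  set u := Real.sqrt (0.505 * x) with hu
  have hx0 : 0 ≤ x := le_trans (by positivity) ((exp_140_ge).trans hx)
  rw [bigT, Chebyshev.theta_eq_sum_primesLE x, Chebyshev.theta_eq_sum_primesLE u,
    ← Finset.sum_sub_distrib]
  have step : ∀ p ∈ Nat.primesLE ⌊x⌋₊,
      (expo x p : ℝ) * Real.log p - Real.log p ≤ if p ≤ ⌊u⌋₊ then Real.log p else 0 := by
    intro p hp
    obtain ⟨hpx, hpp⟩ := Nat.mem_primesLE.1 hp
    have hpxr : (p:ℝ) ≤ x := (Nat.cast_le.2 hpx).trans (Nat.floor_le hx0)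
    have hlp : 0 ≤ Real.log p := Real.log_nonneg (by exact_mod_cast hpp.one_lt.le)
    by_cases hA : (p:ℝ) ^ 2 - p ≤ rho x * Real.log p
    · have he : expo x p = 2 := by unfold expo; rw [if_pos hpxr, if_pos hA]
      have hpu : p ≤ ⌊u⌋₊ := Nat.le_floor (le_sqrt_of_inA2 hx hpp hpxr hA)
      rw [he, if_pos hpu]; push_cast; linarith
    · have he : expo x p = 1 := by unfold expo; rw [if_pos hpxr, if_neg hA]
      rw [he]; push_cast
      split_ifs <;> linarith
  calc ∑ p ∈ Nat.primesLE ⌊x⌋₊, ((expo x p : ℝ) * Real.log p - Real.log p)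
      ≤ ∑ p ∈ Nat.primesLE ⌊x⌋₊, (if p ≤ ⌊u⌋₊ then Real.log p else 0) := Finset.sum_le_sum step
    _ = ∑ p ∈ (Nat.primesLE ⌊x⌋₊).filter (· ≤ ⌊u⌋₊), Real.log p := by
        rw [Finset.sum_filter]
    _ ≤ ∑ p ∈ Nat.primesLE ⌊u⌋₊, Real.log p := by
        refine Finset.sum_le_sum_of_subset_of_nonneg (fun p hp ↦ ?_) (fun p hp _ ↦ ?_)
        · rw [Finset.mem_filter, Nat.mem_primesLE] at hp
          exact Nat.mem_primesLE.2 ⟨hp.2, hp.1.2⟩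
        · exact Real.log_nonneg (by exact_mod_cast (Nat.mem_primesLE.1 hp).2.one_lt.le)

/-- `vSq x ≤ x / 2`. [folklore] -/
private theorem vSq_le {x : ℝ} (hx : Real.exp 2 ≤ x) : vSq x ≤ x / 2 := by
  have hx0 : 0 < x := (Real.exp_pos 2).trans_le hx
  have hlx : 2 ≤ Real.log x := by rw [Real.le_log_iff_exp_le hx0]; exact hx
  have hll : 0 ≤ Real.log (Real.log x) := Real.log_nonneg (by linarith)
  rw [vSq]
  have : 0 ≤ (1 + Real.log (Real.log x)) / Real.log x := by positivity
  nlinarith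

/-- **`L₂(x) − π₁(x) ≥ Σ_{p² ≤ v(x)²} (p² − p)`** for `x ≥ e²`. [cite: MassiasNicolasRobin1988, §4 (6)–(7)] -/
theorem sum_le_lTwo_sub_primeSum {x : ℝ} (hx : Real.exp 2 ≤ x) :
    ∑ p ∈ Nat.primesLE ⌊Real.sqrt (vSq x)⌋₊, ((p:ℝ) ^ 2 - p) ≤ lTwo x - primeSum ⌊x⌋₊ := by
  have hx0 : 0 < x := (Real.exp_pos 2).trans_le hx
  have hx1 : 1 ≤ x := by have := Real.add_one_le_exp (2:ℝ); linarith
  set v := Real.sqrt (vSq x) with hv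
  have hv0 : 0 ≤ v := Real.sqrt_nonneg _
  have hvx : v ≤ x := by
    rw [hv, Real.sqrt_le_left hx0.le]
    have := vSq_le hx; nlinarith
  have hsub : Nat.primesLE ⌊v⌋₊ ⊆ Nat.primesLE ⌊x⌋₊ := by
    intro p hp
    rw [Nat.mem_primesLE] at hp ⊢
    exact ⟨hp.1.trans (Nat.floor_le_floor hvx), hp.2⟩
  rw [lTwo, primeSum]
  push_cast
  rw [← Finset.sum_sub_distrib]
  have heq : ∀ p ∈ Nat.primesLE ⌊v⌋₊, ((p:ℝ) ^ 2 - p) = powOr0 p (expo x p) - p := by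
    intro p hp
    obtain ⟨hpv, hpp⟩ := Nat.mem_primesLE.1 hp
    have hpvr : (p:ℝ) ≤ v := (Nat.cast_le.2 hpv).trans (Nat.floor_le hv0)
    have hpx : (p:ℝ) ≤ x := hpvr.trans hvx
    have hsq : (p:ℝ) ^ 2 ≤ vSq x := by
      have h0 : 0 ≤ vSq x := by
        by_contra h
        push Not at h
        have : v = 0 := by rw [hv]; exact Real.sqrt_eq_zero'.2 h.le
        have hp2 : (2:ℝ) ≤ p := by exact_mod_cast hpp.two_le
        linarith
      calc (p:ℝ) ^ 2 ≤ v ^ 2 := pow_le_pow_left₀ (Nat.cast_nonneg p) hpvr 2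
        _ = vSq x := Real.sq_sqrt h0
    have hA := inA2_of_sq_le_vSq hx hpp hsq
    have he : expo x p = 2 := by unfold expo; rw [if_pos hpx, if_pos hA]
    rw [he, powOr0, if_neg two_ne_zero]
  rw [Finset.sum_congr rfl heq]
  refine Finset.sum_le_sum_of_subset_of_nonneg hsub fun p hp _ ↦ ?_
  obtain ⟨hpx, hpp⟩ := Nat.mem_primesLE.1 hp
  have hpxr : (p:ℝ) ≤ x := (Nat.cast_le.2 hpx).trans (Nat.floor_le hx0.le)
  have hp2 : (2:ℝ) ≤ p := by exact_mod_cast hpp.two_le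
  have h1 := one_le_expo hpxr
  have h2 := expo_le_two x p
  interval_cases h : expo x p
  · rw [powOr0, if_neg one_ne_zero]; simp
  · rw [powOr0, if_neg two_ne_zero]; nlinarith


/-! ## §7 `Σ_{p ≤ v} p² ≥ 0.33 v³/log v` under RH, and `L₂(x) − π₁(x) ≥ 0.19 x^{3/2}/log x` -/

/-- `log 4 < 1.3863`. [folklore] -/
private theorem log_four_lt : Real.log 4 < 1.3863 := by
  rw [show (4:ℝ) = 2 ^ 2 by norm_num, Real.log_pow]
  have := Real.log_two_lt_d9; push_cast; linarith

/-- **RH ⟹ `Σ_{p ≤ v} p² ≥ 0.33 · v³/log v`** for large `v` (Abel summation against `θ`,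
`θ(t) = t + O(√t log²t)` under RH). [cite: MassiasNicolasRobin1988, §6 (main terms x₁^{3/2}/log x₁)] -/
theorem sum_sq_ge (hRH : RiemannHypothesis) :
    ∃ V : ℝ, 2 ≤ V ∧ ∀ v : ℝ, V ≤ v →
      0.33 * (v ^ 3 / Real.log v) ≤ ∑ p ∈ Nat.primesLE ⌊v⌋₊, ((p:ℝ) ^ 2) := by
  obtain ⟨U, hU599, hU⟩ := exists_abs_theta_sub_le_small hRH
  refine ⟨300 * U, by linarith, fun v hv ↦ ?_⟩
  have hU0 : 0 < U := by linarith
  have hvU : U ≤ v := by linarith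
  have hv2 : (2:ℝ) < v := by linarith
  have hv0 : 0 < v := by linarith
  have hlv2 : Real.log 2 ≤ Real.log v := Real.log_le_log (by norm_num) hv2.le
  have hl2 := Real.log_two_gt_d9
  have hlv0 : 0 < Real.log v := by linarith
  -- θ bounds
  have hθ_up : ∀ t : ℝ, 2 ≤ t → t ≤ v → θ t ≤ 1.001 * t + 0.3853 * U := by
    intro t ht _
    have ht0 : 0 ≤ t := by linarith
    rcases le_or_gt U t with hUt | hUt
    · have h1 := (abs_le.1 (hU t hUt)).2
      nlinarith
    · have h1 := Chebyshev.theta_le_log4_mul_x ht0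
      have h2 := log_four_lt
      nlinarith
  have hθv : 0.999 * v ≤ θ v := by
    have h1 := (abs_le.1 (hU v hvU)).1
    linarith
  -- `f2d ≥ 0` on `[2, v]`, `f2 t ≥ t²/log v`
  have hf2d0 : ∀ t : ℝ, 2 ≤ t → 0 ≤ f2d t := by
    intro t ht
    have hlt : Real.log 2 ≤ Real.log t := Real.log_le_log (by norm_num) ht
    rw [f2d]; apply div_nonneg _ (by positivity); nlinarith
  -- the identity
  rw [sum_sq_eq hv2.le]
  -- (c) `∫ f2d = f2 v − f2 2`
  have hf2d_int : ∀ a b : ℝ, 2 ≤ a → a ≤ b → IntervalIntegrable f2d volume a b := fun a b ha hab ↦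
    intervalIntegrable_of_continuousAt (by linarith) hab fun t ht ↦ continuousAt_f2d ht
  have hf2_int : IntervalIntegrable f2 volume 2 v :=
    intervalIntegrable_of_continuousAt one_lt_two hv2.le fun t ht ↦ continuousAt_f2 ht
  have hFTC : ∫ t in (2:ℝ)..v, f2d t = f2 v - f2 2 :=
    intervalIntegral.integral_eq_sub_of_hasDerivAt
      (fun t ht ↦ hasDerivAt_f2 (by rw [Set.uIcc_of_le hv2.le] at ht; linarith [ht.1]))
      (hf2d_int 2 v le_rfl hv2.le)
  have hf22 : 0 ≤ f2 2 := by rw [f2]; positivity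
  -- (d) `∫ t f2d = v f2 v − 2 f2 2 − ∫ f2`, `∫ f2 ≥ (v³ − 8)/(3 log v)`
  have hparts : ∫ t in (2:ℝ)..v, t * f2d t = v * f2 v - 2 * f2 2 - ∫ t in (2:ℝ)..v, f2 t := by
    have := intervalIntegral.integral_mul_deriv_eq_deriv_mul (a := 2) (b := v) (u := fun t : ℝ ↦ t)
      (u' := fun _ ↦ (1:ℝ)) (v := f2) (v' := f2d) (fun t ht ↦ hasDerivAt_id' t)
      (fun t ht ↦ hasDerivAt_f2 (by rw [Set.uIcc_of_le hv2.le] at ht; linarith [ht.1]))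
      intervalIntegrable_const (hf2d_int 2 v le_rfl hv2.le)
    simpa using this
  have hf2_lb : (v ^ 3 - 8) / (3 * Real.log v) ≤ ∫ t in (2:ℝ)..v, f2 t := by
    have h1 : ∫ t in (2:ℝ)..v, t ^ 2 / Real.log v = (v ^ 3 - 8) / (3 * Real.log v) := by
      rw [intervalIntegral.integral_div, integral_pow]
      norm_num
      rw [div_div]
    rw [← h1]
    refine intervalIntegral.integral_mono_on hv2.le ?_ hf2_int fun t ht ↦ ?_
    · exact ((continuous_pow 2).intervalIntegrable _ _).div_const _
    · have ht0 : 0 < t := by linarith [ht.1]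
      have hlt : 0 < Real.log t := Real.log_pos (by linarith [ht.1])
      rw [f2]
      exact div_le_div_of_nonneg_left (by positivity) hlt (Real.log_le_log ht0 ht.2)
  -- (b) `∫ θ f2d ≤ 1.001 ∫ t f2d + 0.3853 U ∫ f2d`
  have hf2dc : ContinuousOn f2d (Set.uIcc 2 v) := by
    rw [Set.uIcc_of_le hv2.le]
    exact continuousOn_of_continuousAt one_lt_two fun t ht ↦ continuousAt_f2d ht
  have hθ_int : IntervalIntegrable (fun t ↦ θ t * f2d t) volume 2 v :=
    (Chebyshev.theta_mono.intervalIntegrable).mul_continuousOn hf2dc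
  have ht_int : IntervalIntegrable (fun t : ℝ ↦ t * f2d t) volume 2 v :=
    intervalIntegrable_of_continuousAt one_lt_two hv2.le fun t ht ↦
      continuousAt_id.mul (continuousAt_f2d ht)
  have hd_int := hf2d_int 2 v le_rfl hv2.le
  have hmix_int : IntervalIntegrable (fun t ↦ 1.001 * (t * f2d t) + 0.3853 * U * f2d t) volume 2 v :=
    (ht_int.const_mul _).add (hd_int.const_mul _)
  have hb : ∫ t in (2:ℝ)..v, θ t * f2d t ≤ ∫ t in (2:ℝ)..v, (1.001 * (t * f2d t) + 0.3853 * U * f2d t) :=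
    intervalIntegral.integral_mono_on hv2.le hθ_int hmix_int fun t ht ↦ by
      have := mul_le_mul_of_nonneg_right (hθ_up t ht.1 ht.2) (hf2d0 t ht.1)
      linarith
  have hb' : ∫ t in (2:ℝ)..v, (1.001 * (t * f2d t) + 0.3853 * U * f2d t)
      = 1.001 * (∫ t in (2:ℝ)..v, t * f2d t) + 0.3853 * U * ∫ t in (2:ℝ)..v, f2d t := by
    rw [intervalIntegral.integral_add (ht_int.const_mul _) (hd_int.const_mul _),
      intervalIntegral.integral_const_mul, intervalIntegral.integral_const_mul]
  -- (a) main term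
  have hmain : 0.999 * v * (v ^ 2 / Real.log v) ≤ θ v * f2 v := by
    rw [f2]; exact mul_le_mul_of_nonneg_right hθv (by positivity)
  -- assemble
  have hf2v : f2 v = v ^ 2 / Real.log v := rfl
  have e1 : v * f2 v = v ^ 3 / Real.log v := by rw [hf2v]; field_simp
  have e3 : 0.999 * v * (v ^ 2 / Real.log v) = 0.999 * (v ^ 3 / Real.log v) := by
    field_simp
  have e2 : v ^ 3 / Real.log v - (v ^ 3 - 8) / (3 * Real.log v)
      = 2 / 3 * (v ^ 3 / Real.log v) + 8 / (3 * Real.log v) := by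
    field_simp; ring
  have j1 : 1.001 * (∫ t in (2:ℝ)..v, t * f2d t)
      ≤ 1.001 * (v ^ 3 / Real.log v - (v ^ 3 - 8) / (3 * Real.log v)) :=
    mul_le_mul_of_nonneg_left (by linarith [hparts, hf2_lb, hf22, e1]) (by norm_num)
  have j2 : 0.3853 * U * (∫ t in (2:ℝ)..v, f2d t) ≤ 0.3853 * U * (v ^ 2 / Real.log v) :=
    mul_le_mul_of_nonneg_left (by linarith [hFTC, hf22, hf2v]) (by positivity)
  have hUv : 0.3853 * U * (v ^ 2 / Real.log v) ≤ 0.0013 * (v ^ 3 / Real.log v) := by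
    rw [mul_div_assoc', mul_div_assoc', div_le_div_iff_of_pos_right hlv0]; nlinarith
  have h8 : (8:ℝ) / (3 * Real.log v) ≤ 0.0001 * (v ^ 3 / Real.log v) := by
    have e : (8:ℝ) / (3 * Real.log v) = (8 / 3) / Real.log v := by rw [div_div]
    rw [e, mul_div_assoc', div_le_div_iff_of_pos_right hlv0]
    have : (599 * 300 : ℝ) ≤ v := by nlinarith
    nlinarith
  have hQ0 : 0 ≤ v ^ 3 / Real.log v := by positivity
  linarith [hmain, hb, hb', j1, j2, e2, e3, hUv, h8, hQ0]


/-- **RH ⟹ `L₂(x) − π₁(x) ≥ 0.19 · x^{3/2}/log x`** for large `x`.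
[cite: MassiasNicolasRobin1988, §4 (6)–(7) and §6] -/
theorem lTwo_sub_primeSum_ge (hRH : RiemannHypothesis) :
    ∃ X : ℝ, ∀ x : ℝ, X ≤ x →
      0.19 * (x * Real.sqrt x / Real.log x) ≤ lTwo x - primeSum ⌊x⌋₊ := by
  obtain ⟨V, hV2, hV⟩ := sum_sq_ge hRH
  obtain ⟨L₀, hL₀⟩ := exists_log_pow_le 1 (s := 1) (ε := 0.045) one_pos (by norm_num)
  obtain ⟨X₁, hX₁⟩ := exists_log_pow_le 1 (s := 1/2) (ε := 0.012) (by norm_num) (by norm_num)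
  refine ⟨max (max (Real.exp (max L₀ 23)) X₁) (3 * V ^ 2), fun x hx ↦ ?_⟩
  have hxe : Real.exp (max L₀ 23) ≤ x := ((le_max_left _ _).trans (le_max_left _ _)).trans hx
  have hxX₁ : X₁ ≤ x := ((le_max_right _ _).trans (le_max_left _ _)).trans hx
  have hxV : 3 * V ^ 2 ≤ x := (le_max_right _ _).trans hx
  have hx0 : 0 < x := (Real.exp_pos _).trans_le hxe
  have hlx : max L₀ 23 ≤ Real.log x := by rw [Real.le_log_iff_exp_le hx0]; exact hxe
  have hL₀x : L₀ ≤ Real.log x := (le_max_left _ _).trans hlx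
  have hl23 : 23 ≤ Real.log x := (le_max_right _ _).trans hlx
  have hlx0 : 0 < Real.log x := by linarith
  have hxe2 : Real.exp 2 ≤ x := by
    have := Real.exp_le_exp.2 (show (2:ℝ) ≤ max L₀ 23 from le_trans (by norm_num) (le_max_right _ _))
    linarith
  have hsx : 0 < Real.sqrt x := Real.sqrt_pos.2 hx0
  have hsx2 : Real.sqrt x ^ 2 = x := Real.sq_sqrt hx0.le
  -- `η ≤ 0.09`
  have hll : Real.log (Real.log x) ≤ 0.045 * Real.log x := by
    have := hL₀ (Real.log x) hL₀x; rwa [pow_one, Real.rpow_one] at this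
  have hll0 : 0 ≤ Real.log (Real.log x) := Real.log_nonneg (by linarith)
  have hη : (1 + Real.log (Real.log x)) / Real.log x ≤ 0.09 := by
    rw [div_le_iff₀ hlx0]; linarith
  have hη0 : 0 ≤ (1 + Real.log (Real.log x)) / Real.log x := by positivity
  have hv2lo : 0.455 * x ≤ vSq x := by rw [vSq]; nlinarith
  have hv2hi : vSq x ≤ x / 2 := vSq_le hxe2
  set v := Real.sqrt (vSq x) with hv
  have hvsq : v ^ 2 = vSq x := Real.sq_sqrt (by linarith)
  have hvlo : 0.6745 * Real.sqrt x ≤ v := Real.le_sqrt_of_sq_le (by nlinarith)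
  have hv0 : 0 < v := lt_of_lt_of_le (by positivity) hvlo
  have hvhi : v ≤ Real.sqrt x := Real.sqrt_le_sqrt (by linarith)
  have hvV : V ≤ v := Real.le_sqrt_of_sq_le (by nlinarith)
  have hv2' : 2 ≤ v := hV2.trans hvV
  have hlv : Real.log v ≤ Real.log x / 2 := by
    calc Real.log v ≤ Real.log (Real.sqrt x) := Real.log_le_log hv0 hvhi
      _ = Real.log x / 2 := Real.log_sqrt hx0.le
  have hlv0 : 0 < Real.log v := Real.log_pos (by linarith)
  -- `S₂(v) ≥ 0.33 v³/log v ≥ 0.2025 Q`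
  have hS2 := hV v hvV
  have hQv : 0.6136 * (x * Real.sqrt x / Real.log x) ≤ v ^ 3 / Real.log v := by
    have h1 : 0.3068 * (x * Real.sqrt x) ≤ v ^ 3 := by
      have e : v ^ 3 = v ^ 2 * v := by ring
      rw [e, hvsq]
      have := mul_le_mul hv2lo hvlo (by positivity) (by linarith)
      nlinarith
    have h2 : 0.6136 * (x * Real.sqrt x / Real.log x) = 0.3068 * (x * Real.sqrt x) / (Real.log x / 2) := by
      field_simp; ring
    rw [h2]
    calc 0.3068 * (x * Real.sqrt x) / (Real.log x / 2) ≤ v ^ 3 / (Real.log x / 2) :=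
          div_le_div_of_nonneg_right h1 (by positivity)
      _ ≤ v ^ 3 / Real.log v := div_le_div_of_nonneg_left (by positivity) hlv0 hlv
  have hP := sum_le_lTwo_sub_primeSum hxe2
  rw [Finset.sum_sub_distrib] at hP
  have hsum_p : ∑ p ∈ Nat.primesLE ⌊v⌋₊, (p:ℝ) ≤ (v + 1) * v := by
    have hcard : ((Nat.primesLE ⌊v⌋₊).card : ℝ) ≤ v + 1 := by
      have h1 : (Nat.primesLE ⌊v⌋₊).card ≤ ⌊v⌋₊ + 1 := by
        rw [Nat.primesLE, Nat.primesBelow]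
        exact (Finset.card_filter_le _ _).trans (by simp)
      have h2 : ((Nat.primesLE ⌊v⌋₊).card : ℝ) ≤ (⌊v⌋₊ : ℝ) + 1 := by exact_mod_cast h1
      linarith [Nat.floor_le hv0.le]
    calc ∑ p ∈ Nat.primesLE ⌊v⌋₊, (p:ℝ) ≤ ∑ p ∈ Nat.primesLE ⌊v⌋₊, v := by
          refine Finset.sum_le_sum fun p hp ↦ ?_
          exact (Nat.cast_le.2 (Nat.mem_primesLE.1 hp).1).trans (Nat.floor_le hv0.le)
      _ = (Nat.primesLE ⌊v⌋₊).card * v := by rw [Finset.sum_const, nsmul_eq_mul]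
      _ ≤ (v + 1) * v := mul_le_mul_of_nonneg_right hcard hv0.le
  have hx_small : x ≤ 0.012 * (x * Real.sqrt x / Real.log x) := by
    have h := hX₁ x hxX₁
    rw [pow_one, ← Real.sqrt_eq_rpow] at h
    rw [mul_div_assoc', le_div_iff₀ hlx0]; nlinarith
  have hvv : (v + 1) * v ≤ x := by nlinarith
  nlinarith [hS2, hQv, hP, hsum_p, hx_small, hvv]

/-! ## §8 Assembly: `li(T(x)²) − L₂(x) + 10x^{4/3} < 0` under RH, MNR Thm 1 (iv), the discharge -/

/-- `log 0.999 ≥ −0.0011`. [folklore] -/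
private theorem log_0999 : (-0.0011:ℝ) ≤ Real.log 0.999 := by
  have := Real.one_sub_inv_le_log_of_pos (show (0:ℝ) < 0.999 by norm_num)
  norm_num at this ⊢; linarith

/-- **RH ⟹ `J(T(x)) − J(θ(x)) ≤ 0.714 · x^{3/2}/log x`** (and `θ(x) ≥ e`) for large `x`.
[cite: MassiasNicolasRobin1988, §6 and §4 (7)] -/
theorem liSq_bigT_sub_le (hRH : RiemannHypothesis) :
    ∃ X : ℝ, ∀ x : ℝ, X ≤ x →
      liSq (bigT x) - liSq (θ x) ≤ 0.714 * (x * Real.sqrt x / Real.log x) ∧ Real.exp 1 ≤ θ x := by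
  obtain ⟨U, hU599, hU⟩ := exists_abs_theta_sub_le_small hRH
  refine ⟨max (Real.exp 1000) (2 * U ^ 2), fun x hx ↦ ?_⟩
  have hxe : Real.exp 1000 ≤ x := (le_max_left _ _).trans hx
  have hxU2 : 2 * U ^ 2 ≤ x := (le_max_right _ _).trans hx
  have hx0 : 0 < x := (Real.exp_pos _).trans_le hxe
  have hlx : 1000 ≤ Real.log x := by rw [Real.le_log_iff_exp_le hx0]; exact hxe
  have hlx0 : 0 < Real.log x := by linarith
  have hxU : U ≤ x := by nlinarith
  have hx140 : Real.exp 140 ≤ x := le_trans (Real.exp_le_exp.2 (by norm_num)) hxe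
  have hsx : 0 < Real.sqrt x := Real.sqrt_pos.2 hx0
  have hsx2 : Real.sqrt x * Real.sqrt x = x := Real.mul_self_sqrt hx0.le
  -- `θ(x)`
  have hθ1 := abs_le.1 (hU x hxU)
  have hθlo : 0.999 * x ≤ θ x := by linarith [hθ1.1]
  have hθhi : θ x ≤ 1.001 * x := by linarith [hθ1.2]
  have he1 : Real.exp 1 < 3 := by have := Real.exp_one_lt_d9; linarith
  have hx6 : (506090:ℝ) ≤ x := by
    have := Real.add_one_le_exp (1000:ℝ)
    nlinarith [hU599]
  have hθe : Real.exp 1 ≤ θ x := by linarith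
  -- `u = √(0.505 x)`
  set u := Real.sqrt (0.505 * x) with hu
  have huU : U ≤ u := Real.le_sqrt_of_sq_le (by nlinarith)
  have hule : u ≤ 0.71064 * Real.sqrt x := by
    rw [hu, Real.sqrt_le_iff]; constructor
    · positivity
    · nlinarith
  have hθu : θ u ≤ 1.001 * u := by
    have h1 := (abs_le.1 (hU u huU)).2
    linarith
  have hTθ : bigT x - θ x ≤ 0.7114 * Real.sqrt x := by
    have := bigT_sub_theta_le hx140
    rw [← hu] at this
    nlinarith [Real.sqrt_nonneg x]
  have hT0 : θ x ≤ bigT x := theta_le_bigT hx0.le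
  have hsx_small : 0.7114 * Real.sqrt x ≤ 0.001 * x := by
    have h1 : (711.4:ℝ) ≤ Real.sqrt x := Real.le_sqrt_of_sq_le (by nlinarith)
    nlinarith [h1, hsx2, hsx]
  have hThi : bigT x ≤ 1.002 * x := by linarith
  have hTe : Real.exp 1 ≤ bigT x := hθe.trans hT0
  have hT0' : 0 < bigT x := (Real.exp_pos 1).trans_le hTe
  -- `log T ≥ log x − 0.0011`
  have hlogT : Real.log x - 0.0011 ≤ Real.log (bigT x) := by
    have h1 : Real.log (0.999 * x) ≤ Real.log (bigT x) :=
      Real.log_le_log (by positivity) (hθlo.trans hT0)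
    rw [Real.log_mul (by norm_num) hx0.ne'] at h1
    linarith [log_0999]
  have hlT0 : 0 < Real.log (bigT x) := by linarith
  have hTlog : bigT x / Real.log (bigT x) ≤ 1.0022 * (x / Real.log x) := by
    rw [div_le_iff₀ hlT0, mul_div_assoc', div_mul_eq_mul_div, le_div_iff₀ hlx0]
    have h1 : 1.0022 * x * (Real.log x - 0.0011) ≤ 1.0022 * x * Real.log (bigT x) :=
      mul_le_mul_of_nonneg_left hlogT (by positivity)
    nlinarith
  refine ⟨?_, hθe⟩
  calc liSq (bigT x) - liSq (θ x) ≤ (bigT x - θ x) * (bigT x / Real.log (bigT x)) :=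
        liSq_sub_liSq_le' hTe hθe
    _ ≤ (0.7114 * Real.sqrt x) * (1.0022 * (x / Real.log x)) :=
        mul_le_mul hTθ hTlog (by positivity) (by positivity)
    _ = (0.7114 * 1.0022) * (x * Real.sqrt x / Real.log x) := by ring
    _ ≤ 0.714 * (x * Real.sqrt x / Real.log x) :=
        mul_le_mul_of_nonneg_right (by norm_num) (by positivity)

/-- **RH ⟹ `J(θ(x)) − π₁(x) ≤ −0.59 · x^{3/2}/log x`** for large `x`.
[cite: MassiasNicolasRobin1988, §6 (Li(θ²) − π₁ via Lemme C) and Thm. 1 (v)] -/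
theorem liSq_theta_sub_primeSum_le (hRH : RiemannHypothesis) :
    ∃ X : ℝ, ∀ x : ℝ, X ≤ x →
      liSq (θ x) - primeSum ⌊x⌋₊ ≤ -0.59 * (x * Real.sqrt x / Real.log x) := by
  obtain ⟨K, X₀, hK0, hX₀3, hK⟩ := LiThetaRH.exists_abs_theta_sub_le_of_RH hRH
  obtain ⟨X₈, hX₈⟩ := exists_log_pow_le 2 (s := 1/2) (ε := 0.001 / K) (by norm_num) (by positivity)
  obtain ⟨X₄, hX₄2, h4⟩ := integral_psi_sub_mul_w1_le hRH
  obtain ⟨X₅, hX₅2, h5⟩ := integral_psi_sub_theta_mul_w1_ge hRH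
  obtain ⟨X₆, hX₆⟩ := exists_log_pow_le 4 (s := 1/2) (ε := 0.004 / K ^ 2) (by norm_num) (by positivity)
  refine ⟨max (max X₄ X₅) (max X₆ (max (max X₀ X₈) (Real.exp 10))), fun x hx ↦ ?_⟩
  have hx4 : X₄ ≤ x := ((le_max_left _ _).trans (le_max_left _ _)).trans hx
  have hx5 : X₅ ≤ x := ((le_max_right _ _).trans (le_max_left _ _)).trans hx
  have hx6 : X₆ ≤ x := ((le_max_left _ _).trans (le_max_right _ _)).trans hx
  have hxU : X₀ ≤ x :=
    ((((le_max_left _ _).trans (le_max_left _ _)).trans (le_max_right _ _)).trans (le_max_right _ _)).trans hx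
  have hx8 : X₈ ≤ x :=
    ((((le_max_right _ _).trans (le_max_left _ _)).trans (le_max_right _ _)).trans (le_max_right _ _)).trans hx
  have hxe : Real.exp 10 ≤ x := (((le_max_right _ _).trans (le_max_right _ _)).trans (le_max_right _ _)).trans hx
  have hx0 : 0 < x := by linarith
  have hx2 : (2:ℝ) ≤ x := by linarith
  have hlx : 10 ≤ Real.log x := by rw [Real.le_log_iff_exp_le hx0]; exact hxe
  have hlx0 : 0 < Real.log x := by linarith
  have hsx : 0 < Real.sqrt x := Real.sqrt_pos.2 hx0
  have hsx2 : Real.sqrt x * Real.sqrt x = x := Real.mul_self_sqrt hx0.le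
  set E : ℝ := K * Real.sqrt x * Real.log x ^ 2 with hE
  have hθE : |θ x - x| ≤ E := hK x hxU
  have hEx : E ≤ 0.001 * x := by
    have h2 := hX₈ x hx8
    rw [← Real.sqrt_eq_rpow] at h2
    calc E ≤ K * Real.sqrt x * (0.001 / K * Real.sqrt x) := mul_le_mul_of_nonneg_left h2 (by positivity)
      _ = 0.001 * (Real.sqrt x * Real.sqrt x) := by field_simp
      _ = 0.001 * x := by rw [hsx2]
  have he3 : Real.exp 1 < 3 := by have := Real.exp_one_lt_d9; linarith
  have hx11 : (11:ℝ) ≤ x := by have := Real.add_one_le_exp (10:ℝ); linarith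
  have hxE : Real.exp 1 ≤ x - E := by linarith
  have htan := liSq_sub_liSq_le hθE hxE
  have hid := primeSum_sub_liSq_eq hx2
  -- `∫(θ − t) w′ = ∫(ψ − t) w′ − ∫(ψ − θ) w′`
  have hw1c : ContinuousOn w1 (Set.uIcc 2 x) := by
    rw [Set.uIcc_of_le hx2]
    exact continuousOn_of_continuousAt one_lt_two fun t ht ↦ continuousAt_w1 ht
  have hA : IntervalIntegrable (fun t ↦ (ψ t - t) * w1 t) volume 2 x :=
    ((Chebyshev.psi_mono.intervalIntegrable).sub (continuous_id.intervalIntegrable _ _)).mul_continuousOn hw1c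
  have hB : IntervalIntegrable (fun t ↦ (ψ t - θ t) * w1 t) volume 2 x :=
    ((Chebyshev.psi_mono.intervalIntegrable).sub (Chebyshev.theta_mono.intervalIntegrable)).mul_continuousOn hw1c
  have hsplit : ∫ t in (2:ℝ)..x, (θ t - t) * w1 t
      = (∫ t in (2:ℝ)..x, (ψ t - t) * w1 t) - ∫ t in (2:ℝ)..x, (ψ t - θ t) * w1 t := by
    rw [← intervalIntegral.integral_sub hA hB]
    refine intervalIntegral.integral_congr fun t _ ↦ ?_
    show _ = _ - _; ring
  have hI1 := h4 x hx4
  have hI2 := h5 x hx5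
  -- `E²/log x ≤ 0.004 Q`
  have hE2 : E ^ 2 / Real.log x ≤ 0.004 * (x * Real.sqrt x / Real.log x) := by
    have h := hX₆ x hx6
    rw [← Real.sqrt_eq_rpow] at h
    have e1 : E ^ 2 = K ^ 2 * Real.log x ^ 4 * x := by
      rw [hE, mul_pow, mul_pow, Real.sq_sqrt hx0.le]; ring
    rw [e1, mul_div_assoc']
    refine div_le_div_of_nonneg_right ?_ hlx0.le
    have p1 : K ^ 2 * Real.log x ^ 4 ≤ 0.004 * Real.sqrt x := by
      have := mul_le_mul_of_nonneg_left h (sq_nonneg K)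
      rwa [← mul_assoc, mul_div_cancel₀ _ (pow_ne_zero 2 hK0.ne')] at this
    nlinarith [p1, hx0]
  have hw2 : 0 < w 2 := by rw [w]; exact div_pos two_pos (Real.log_pos one_lt_two)
  have hQ0 : 0 ≤ x * Real.sqrt x / Real.log x := by positivity
  linarith [htan, hid, hsplit, hI1, hI2, hE2, hw2, hQ0]

/-- **RH ⟹ `li(T(x)²) − L₂(x) + 10 x^{4/3} < 0`** (and `θ(x) ≥ e`) for large `x`: the estimate
(∗) of the module docstring. [cite: MassiasNicolasRobin1988, Thm. 1 (iv)–(v), §6] -/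
theorem logIntegral_bigT_sq_sub_lTwo_neg (hRH : RiemannHypothesis) :
    ∃ X : ℝ, 4 ≤ X ∧ ∀ x : ℝ, X ≤ x →
      logIntegral (bigT x ^ 2) - lTwo x + 10 * (x * x ^ ((1:ℝ)/3)) < 0 ∧ Real.exp 1 ≤ θ x := by
  obtain ⟨X₁, h1⟩ := liSq_bigT_sub_le hRH
  obtain ⟨X₂, h2⟩ := liSq_theta_sub_primeSum_le hRH
  obtain ⟨X₃, h3⟩ := lTwo_sub_primeSum_ge hRH
  obtain ⟨X₇, hX₇⟩ := exists_log_pow_le 1 (s := 1/6) (ε := 0.003) (by norm_num) (by norm_num)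
  refine ⟨max (max (max X₁ X₂) (max X₃ X₇)) (max 4 (100 * |logIntegral 4| + Real.exp 2)),
    (le_max_left _ _).trans (le_max_right _ _), fun x hx ↦ ?_⟩
  have hx1 : X₁ ≤ x := (((le_max_left _ _).trans (le_max_left _ _)).trans (le_max_left _ _)).trans hx
  have hx2 : X₂ ≤ x := (((le_max_right _ _).trans (le_max_left _ _)).trans (le_max_left _ _)).trans hx
  have hx3 : X₃ ≤ x := (((le_max_left _ _).trans (le_max_right _ _)).trans (le_max_left _ _)).trans hx
  have hx7 : X₇ ≤ x := (((le_max_right _ _).trans (le_max_right _ _)).trans (le_max_left _ _)).trans hx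
  have hxc : 100 * |logIntegral 4| + Real.exp 2 ≤ x := ((le_max_right _ _).trans (le_max_right _ _)).trans hx
  have hx0 : 0 < x := by have := Real.exp_pos 2; have := abs_nonneg (logIntegral 4); linarith
  have hxe2 : Real.exp 2 ≤ x := by have := abs_nonneg (logIntegral 4); linarith
  have hlx : 2 ≤ Real.log x := by rw [Real.le_log_iff_exp_le hx0]; exact hxe2
  have hlx0 : 0 < Real.log x := by linarith
  have hsx : 0 < Real.sqrt x := Real.sqrt_pos.2 hx0
  obtain ⟨hP1, hθe⟩ := h1 x hx1
  have hP2 := h2 x hx2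
  have hP3 := h3 x hx3
  have hTe : Real.exp 1 ≤ bigT x := hθe.trans (theta_le_bigT hx0.le)
  have he2 : (2:ℝ) < Real.exp 1 := by have := Real.exp_one_gt_d9; linarith
  rw [logIntegral_sq_eq (by linarith)]
  -- `10 x^{4/3} ≤ 0.03 Q`
  have h16 := hX₇ x hx7
  rw [pow_one] at h16
  have hx13 : 0 < x ^ ((1:ℝ)/3) := Real.rpow_pos_of_pos hx0 _
  have hhalf : x ^ ((1:ℝ)/3) * x ^ ((1:ℝ)/6) = Real.sqrt x := by
    rw [← Real.rpow_add hx0, Real.sqrt_eq_rpow]; norm_num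
  have a1 : 10 * (x * x ^ ((1:ℝ)/3)) ≤ 0.03 * (x * Real.sqrt x / Real.log x) := by
    rw [mul_div_assoc', le_div_iff₀ hlx0, ← hhalf]
    have := mul_le_mul_of_nonneg_left h16 hx13.le
    nlinarith
  -- `li 4 ≤ 0.03 Q` (using `log x ≤ 0.003 x^{1/6} ≤ 0.003 √x`)
  have a2 : logIntegral 4 ≤ 0.03 * (x * Real.sqrt x / Real.log x) := by
    have h61 : x ^ ((1:ℝ)/6) ≤ Real.sqrt x := by
      rw [Real.sqrt_eq_rpow]
      exact Real.rpow_le_rpow_of_exponent_le (by linarith [Real.add_one_le_exp (2:ℝ)]) (by norm_num)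
    have hls : Real.log x ≤ 0.003 * Real.sqrt x := h16.trans (by nlinarith)
    have hQx : x ≤ x * Real.sqrt x / Real.log x := by
      rw [le_div_iff₀ hlx0]; nlinarith
    have := le_abs_self (logIntegral 4)
    have := Real.exp_pos (2:ℝ)
    have hQ0 : 0 ≤ x * Real.sqrt x / Real.log x := by positivity
    nlinarith
  constructor
  · nlinarith [hP1, hP2, hP3, a1, a2]
  · exact hθe

/-- **MNR 1988, Thm. 1 (iv)**: under the Riemann hypothesis, `log g(n) < √(li⁻¹(n))` for all
large `n`. [cite: MassiasNicolasRobin1988, Thm. 1 (iv)] -/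
theorem eventually_log_landauFn_lt_of_riemannHypothesis (hRH : RiemannHypothesis) :
    ∃ n₀ : ℕ, ∀ n : ℕ, n₀ ≤ n → ∀ y : ℝ, 1 < y → logIntegral y = n →
      Real.log (landauFn n) < Real.sqrt y := by
  obtain ⟨X, hX4, hX⟩ := logIntegral_bigT_sq_sub_lTwo_neg hRH
  refine ⟨⌈Real.exp X⌉₊, fun n hn y hy hyn ↦ ?_⟩
  have hn0 : Real.exp X ≤ n := (Nat.le_ceil _).trans (by exact_mod_cast hn)
  have hnpos : (0:ℝ) < n := (Real.exp_pos X).trans_le hn0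
  have hg : (n:ℝ) ≤ landauFn n := by exact_mod_cast le_landauFn n
  have hlog : X ≤ Real.log (landauFn n) := by
    have h1 : X ≤ Real.log n := by rw [Real.le_log_iff_exp_le hnpos]; exact hn0
    exact h1.trans (Real.log_le_log hnpos hg)
  obtain ⟨hneg, hθ⟩ := hX _ hlog
  exact log_landauFn_lt_sqrt hy hyn (hX4.trans hlog) hθ hneg

end LandauFnUpperRH

/-- **DISCHARGE of `MassiasNicolasRobin1988_iff`** (Broughan vol. 1, Ch. 10, the symmetric-group
criterion): `RH ⟺ log g(n) < √(li⁻¹(n))` for all large `n` — `⟹` is MNR Thm. 1 (iv)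
(`LandauFnUpperRH.eventually_log_landauFn_lt_of_riemannHypothesis`), `⟸` is the `Ω₊` part of
Thm. 1 (ii) (`LandauFnOmega.riemannHypothesis_of_eventually_log_landauFn_lt`).
[cite: MassiasNicolasRobin1988, Thm. 1 (ii), (iv)] -/
theorem MassiasNicolasRobin1988_iff_holds : MassiasNicolasRobin1988_iff :=
  ⟨LandauFnUpperRH.eventually_log_landauFn_lt_of_riemannHypothesis,
    LandauFnOmega.riemannHypothesis_of_eventually_log_landauFn_lt⟩

/-- The `⟸` half of the Deléglise–Nicolas form (`∀ n ≥ 1`) is implied by the asymptotic form.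
[cite: DelegliseNicolas2019, Thm. 1.1 (i) and Cor. 1.3] -/
theorem DelegliseNicolas2019_iff_mpr
    (h : ∀ n : ℕ, 1 ≤ n → ∀ y : ℝ, 1 < y → logIntegral y = n →
      Real.log (landauFn n) < Real.sqrt y) : RiemannHypothesis :=
  LandauFnOmega.riemannHypothesis_of_eventually_log_landauFn_lt ⟨1, h⟩


/-! ## §9 The two-layer numbers `N_ρ` (MNR §4 (3)–(6)) and the lower bound `T(x) ≤ log g(n)`

RH-FREE. For `x ≥ 4`, `ρ = x/log x`, MNR [§4 (3)] set `N_ρ = ∏_{p ≤ x} p^{α_p}` with the exponent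
pattern `α_p = expo x p`; then `ℓ(N_ρ) = L₂(x)`, `log N_ρ = T(x)`, `N_ρ ∈ g(ℕ)` and (5)–(6):
`p^{α_p} ≤ x`, `θ(x) ≤ log N_ρ ≤ ψ(x)`. -/

namespace LandauFnUpperRH

open LandauFnUpper LandauFnOmega

/-- the exponent pattern of `N_ρ` as a finitely supported function (supported on the primes `≤ x`).
[cite: MassiasNicolasRobin1988, §4 (3)] -/
noncomputable def expoF (x : ℝ) : ℕ →₀ ℕ :=
  Finsupp.onFinset (Nat.primesLE ⌊x⌋₊) (fun p ↦ if p ∈ Nat.primesLE ⌊x⌋₊ then expo x p else 0)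
    (fun _ hp ↦ by by_contra h; exact hp (if_neg h))

/-- **`N_ρ = ∏_{p ≤ x} p^{α_p}`**, `ρ = x/log x`. [cite: MassiasNicolasRobin1988, §4 (3)] -/
noncomputable def enn (x : ℝ) : ℕ := (expoF x).prod (· ^ ·)

/-- values of `expoF`. [cite: MassiasNicolasRobin1988, §4 (3)] -/
theorem expoF_apply (x : ℝ) (p : ℕ) :
    expoF x p = if p ∈ Nat.primesLE ⌊x⌋₊ then expo x p else 0 := by
  rw [expoF, Finsupp.onFinset_apply]

/-- the support of `expoF` is contained in the primes `≤ x`. [cite: MassiasNicolasRobin1988, §4 (3)] -/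
theorem support_expoF_subset (x : ℝ) : (expoF x).support ⊆ Nat.primesLE ⌊x⌋₊ := by
  rw [expoF]; exact Finsupp.support_onFinset_subset

/-- `N_ρ` has factorization `expoF`. [cite: MassiasNicolasRobin1988, §4 (3)] -/
theorem factorization_enn (x : ℝ) : (enn x).factorization = expoF x :=
  Nat.prod_pow_factorization_eq_self fun _ hp ↦
    (Nat.mem_primesLE.1 (support_expoF_subset x hp)).2

/-- `N_ρ ≠ 0`. [cite: MassiasNicolasRobin1988, §4 (3)] -/
theorem enn_ne_zero (x : ℝ) : enn x ≠ 0 := by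
  rw [enn, Finsupp.prod]
  exact Finset.prod_ne_zero_iff.2 fun p hp ↦
    pow_ne_zero _ (Nat.mem_primesLE.1 (support_expoF_subset x hp)).2.ne_zero

/-- for `x ≥ 0` and a prime `p ≤ x`: `expoF x p = expo x p ≥ 1`. [cite: MassiasNicolasRobin1988, §4 (3)] -/
theorem expoF_of_mem {x : ℝ} {p : ℕ} (hp : p ∈ Nat.primesLE ⌊x⌋₊) : expoF x p = expo x p := by
  rw [expoF_apply, if_pos hp]

/-- **`ℓ(N_ρ) = L₂(x)`** (`x ≥ 0`). [cite: MassiasNicolasRobin1988, §4 (3)–(4)] -/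
theorem ell_enn {x : ℝ} (hx : 0 ≤ x) : (ell (enn x) : ℝ) = lTwo x := by
  have hS : (enn x).primeFactors ⊆ Nat.primesLE ⌊x⌋₊ := by
    rw [← Nat.support_factorization, factorization_enn]; exact support_expoF_subset x
  rw [ell_eq_sum_term hS, lTwo]
  push_cast
  refine Finset.sum_congr rfl fun p hp ↦ ?_
  have hpx : (p:ℝ) ≤ x := (Nat.cast_le.2 (Nat.mem_primesLE.1 hp).1).trans (Nat.floor_le hx)
  have he : expo x p ≠ 0 := by have := one_le_expo hpx; omega
  rw [term_cast, factorization_enn, expoF_of_mem hp]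

/-- **`log N_ρ = T(x)`**. [cite: MassiasNicolasRobin1988, §4 (3), (6)] -/
theorem log_enn (x : ℝ) : Real.log (enn x) = bigT x := by
  rw [enn, Finsupp.prod]
  push_cast
  rw [Real.log_prod]
  · rw [bigT]
    have hsub := support_expoF_subset x
    rw [Finset.sum_subset hsub (fun p _ hp ↦ by
      rw [Finsupp.notMem_support_iff.1 hp, pow_zero, Real.log_one])]
    refine Finset.sum_congr rfl fun p hp ↦ ?_
    rw [Real.log_pow, expoF_of_mem hp]
  · intro p hp
    exact pow_ne_zero _ (by exact_mod_cast (Nat.mem_primesLE.1 (support_expoF_subset x hp)).2.ne_zero)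

/-- **`L₂(x) ≤ n ⟹ T(x) ≤ log g(n)`** (`N_ρ` is the order of a permutation of `ℓ(N_ρ) = L₂(x) ≤ n`
letters; MNR: `N_ρ ∈ G ⊂ g(ℕ)`). [cite: MassiasNicolasRobin1988, §4 (3) and (∗)] -/
theorem bigT_le_log_landauFn {x : ℝ} (hx : 0 ≤ x) {n : ℕ} (h : lTwo x ≤ n) :
    bigT x ≤ Real.log (landauFn n) := by
  have h1 : ell (enn x) ≤ n := by
    have := ell_enn hx; exact_mod_cast (this ▸ h : (ell (enn x) : ℝ) ≤ n)
  have h2 := le_landauFn_of_ell_le (enn_ne_zero x) h1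
  rw [← log_enn]
  exact Real.log_le_log (by exact_mod_cast Nat.pos_of_ne_zero (enn_ne_zero x)) (by exact_mod_cast h2)

/-- **MNR §4 (5)**: `p^{α_p} ≤ x` for every prime `p ≤ x` (here for `x ≥ e^{140}`).
[cite: MassiasNicolasRobin1988, §4 (5)] -/
theorem pow_expo_le {x : ℝ} (hx : Real.exp 140 ≤ x) {p : ℕ} (hp : p.Prime) (hpx : (p:ℝ) ≤ x) :
    (p:ℝ) ^ expo x p ≤ x := by
  have hx0 : 0 < x := (Real.exp_pos _).trans_le hx
  by_cases hA : (p : ℝ) ^ 2 - p ≤ rho x * Real.log p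
  · have he : expo x p = 2 := by unfold expo; rw [if_pos hpx, if_pos hA]
    rw [he]
    have h1 := le_sqrt_of_inA2 hx hp hpx hA
    have h2 : (p:ℝ) ^ 2 ≤ 0.505 * x := by
      calc (p:ℝ) ^ 2 ≤ Real.sqrt (0.505 * x) ^ 2 := pow_le_pow_left₀ (Nat.cast_nonneg p) h1 2
        _ = 0.505 * x := Real.sq_sqrt (by positivity)
    linarith
  · have he : expo x p = 1 := by unfold expo; rw [if_pos hpx, if_neg hA]
    rw [he, pow_one]; exact hpx

/-- **MNR §4 (6), left**: `θ(x) ≤ log N_ρ`. [cite: MassiasNicolasRobin1988, §4 (6)] -/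
theorem theta_le_log_enn {x : ℝ} (hx : 0 ≤ x) : θ x ≤ Real.log (enn x) := by
  rw [log_enn]; exact theta_le_bigT hx

/-- **MNR §4 (6), right**: `log N_ρ ≤ ψ(x)` (here for `x ≥ e^{140}`): `log N_ρ − θ(x) ≤ θ(√(0.505x))
≤ ψ(√x) ≤ ψ(x) − θ(x)`. [cite: MassiasNicolasRobin1988, §4 (6)] -/
theorem log_enn_le_psi {x : ℝ} (hx : Real.exp 140 ≤ x) : Real.log (enn x) ≤ ψ x := by
  have hx0 : 0 < x := (Real.exp_pos _).trans_le hx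
  rw [log_enn]
  have h1 := bigT_sub_theta_le hx
  have h2 : θ (Real.sqrt (0.505 * x)) ≤ θ (Real.sqrt x) :=
    Chebyshev.theta_mono (Real.sqrt_le_sqrt (by linarith))
  have h3 := Chebyshev.theta_le_psi (Real.sqrt x)
  have h4 := Chebyshev.psi_sub_theta_ge_psi_add_psi_add_psi hx0.le
  have h5 : ψ (x ^ (2:ℝ)⁻¹) = ψ (Real.sqrt x) := by
    rw [Real.sqrt_eq_rpow, show ((2:ℝ)⁻¹) = 1 / 2 by norm_num]
  have h6 := Chebyshev.psi_nonneg (x ^ (3:ℝ)⁻¹)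
  have h7 := Chebyshev.psi_nonneg (x ^ (7:ℝ)⁻¹)
  rw [h5] at h4
  linarith



/-! ## §10 Lower estimates under RH: `L₂(x) ≤ li(T(x)²) + 36 x^{3/2}/log x` -/

/-- **RH ⟹ `∫₂ˣ (ψ(t) − t) w′(t) dt ≥ −0.06 · x^{3/2}/log x`** for large `x` (the lower companion
of `integral_psi_sub_mul_w1_le`, same integration by parts). [cite: MontgomeryVaughan2007, (13.6)–(13.8)] -/
theorem integral_psi_sub_mul_w1_ge (hRH : RiemannHypothesis) :
    ∃ X : ℝ, 2 ≤ X ∧ ∀ x : ℝ, X ≤ x →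
      -(0.06 * (x * Real.sqrt x / Real.log x)) ≤ ∫ t in (2:ℝ)..x, (ψ t - t) * w1 t := by
  obtain ⟨T, hT2, hT⟩ := LiThetaRH.exists_abs_psiOneErr_le_of_RH hRH
  have hcontErr : Continuous LiThetaRH.psiOneErr := by
    unfold LiThetaRH.psiOneErr; exact NicolasJ.continuous_psiOne.sub (by continuity)
  obtain ⟨M, hM⟩ : ∃ M : ℝ, ∀ t ∈ Set.Icc 2 T, |LiThetaRH.psiOneErr t| ≤ M := by
    obtain ⟨M, hM⟩ := isCompact_Icc.exists_bound_of_continuousOn hcontErr.continuousOn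
    exact ⟨M, fun t ht ↦ by simpa [Real.norm_eq_abs] using hM t ht⟩
  have hM0 : 0 ≤ M := (abs_nonneg _).trans (hM 2 ⟨le_rfl, hT2⟩)
  have hR : ∀ t : ℝ, 2 ≤ t → |LiThetaRH.psiOneErr t| ≤ 0.05 * (t * Real.sqrt t) + M := by
    intro t ht
    have h0 : 0 ≤ 0.05 * (t * Real.sqrt t) := by positivity
    rcases le_or_gt T t with hTt | hTt
    · have := hT t hTt; rw [rpow_three_halves (by linarith)] at this; linarith
    · have := hM t ⟨ht, hTt.le⟩; linarith
  set K : ℝ := 8.4 * M + 2 + |LiThetaRH.psiOneErr 2 * w1 2| with hK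
  have hK0 : 0 < K := by rw [hK]; positivity
  obtain ⟨X₁, hX₁⟩ := exists_log_pow_le 2 (s := 1/2) (ε := 1) (by norm_num) one_pos
  obtain ⟨X₂, hX₂⟩ := exists_log_pow_le 1 (s := 1/2) (ε := 0.005 / K) (by norm_num) (by positivity)
  have h244 : (2:ℝ) ≤ Real.exp 244 := by have := Real.add_one_le_exp (244:ℝ); linarith
  refine ⟨max (max X₁ X₂) (max (Real.exp 244) T),
    h244.trans ((le_max_left _ _).trans (le_max_right _ _)), fun x hx ↦ ?_⟩
  have hx244 : Real.exp 244 ≤ x := ((le_max_left _ _).trans (le_max_right _ _)).trans hx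
  have hxT : T ≤ x := ((le_max_right _ _).trans (le_max_right _ _)).trans hx
  have hxX₁ : X₁ ≤ x := ((le_max_left _ _).trans (le_max_left _ _)).trans hx
  have hxX₂ : X₂ ≤ x := ((le_max_right _ _).trans (le_max_left _ _)).trans hx
  have hx2 : (2:ℝ) < x := by have := Real.add_one_le_exp (244:ℝ); linarith
  have hx0 : 0 < x := by linarith
  have hlx : 244 ≤ Real.log x := by rw [Real.le_log_iff_exp_le hx0]; exact hx244
  have hlx0 : 0 < Real.log x := by linarith
  have hsx : 0 < Real.sqrt x := Real.sqrt_pos.2 hx0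
  have hsqrt_eq : x ^ ((1:ℝ)/2) = Real.sqrt x := (Real.sqrt_eq_rpow x).symm
  have hex : Real.exp 1 ≤ x := by
    have := Real.exp_le_exp.2 (show (1:ℝ) ≤ 244 by norm_num); linarith
  -- main term
  have hGx : -(0.05 * (x * Real.sqrt x / Real.log x)) ≤ LiThetaRH.psiOneErr x * w1 x := by
    have hw := w1_bounds hex
    have h2 := hT x hxT
    rw [rpow_three_halves hx0.le] at h2
    have h3 : |LiThetaRH.psiOneErr x| * w1 x ≤ (0.05 * (x * Real.sqrt x)) * (1 / Real.log x) :=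
      mul_le_mul h2 hw.2 hw.1 (by positivity)
    have h4 : -(|LiThetaRH.psiOneErr x| * w1 x) ≤ LiThetaRH.psiOneErr x * w1 x := by
      rw [← neg_mul]; exact mul_le_mul_of_nonneg_right (neg_abs_le _) hw.1
    have e : (0.05 * (x * Real.sqrt x)) * (1 / Real.log x) = 0.05 * (x * Real.sqrt x / Real.log x) := by
      ring
    linarith
  -- error integral
  have hBle : ∀ t ∈ Set.Icc 2 x, |LiThetaRH.psiOneErr t * w2 t| ≤ bnd M t := by
    intro t ht
    have ht0 : 0 < t := by linarith [ht.1]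
    have hlt : 0 < Real.log t := Real.log_pos (by linarith [ht.1])
    rw [abs_mul]
    calc |LiThetaRH.psiOneErr t| * |w2 t|
        ≤ (0.05 * (t * Real.sqrt t) + M) * (4 / (t * Real.log t ^ 2)) :=
          mul_le_mul (hR t ht.1) (abs_w2_le ht.1) (abs_nonneg _) (by positivity)
      _ = bnd M t := by unfold bnd; field_simp; ring
  have hB_int : IntervalIntegrable (fun t ↦ LiThetaRH.psiOneErr t * w2 t) volume 2 x := by
    refine (hcontErr.intervalIntegrable _ _).mul_continuousOn ?_
    rw [Set.uIcc_of_le hx2.le]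
    exact continuousOn_of_continuousAt one_lt_two fun t ht ↦ continuousAt_w2 ht
  have hBint_le : (∫ t in (2:ℝ)..x, LiThetaRH.psiOneErr t * w2 t) ≤ ∫ t in (2:ℝ)..x, bnd M t :=
    intervalIntegral.integral_mono_on hx2.le hB_int (intervalIntegrable_bnd M le_rfl hx2.le)
      (fun t ht ↦ (le_abs_self _).trans (hBle t ht))
  have hX₁' := hX₁ x hxX₁
  rw [hsqrt_eq, one_mul] at hX₁'
  have hbnd := integral_bnd_le hM0 hx244 hX₁'
  -- absorb the lower-order terms
  have a1 : 1.22 * (x * Real.sqrt x / Real.log x ^ 2) ≤ 0.005 * (x * Real.sqrt x / Real.log x) := by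
    have hq : x * Real.sqrt x / Real.log x ^ 2 = (x * Real.sqrt x / Real.log x) / Real.log x := by
      field_simp
    rw [hq, mul_div_assoc', div_le_iff₀ hlx0]
    have h0 : 0 < x * Real.sqrt x / Real.log x := by positivity
    nlinarith
  have a2 : K * x ≤ 0.005 * (x * Real.sqrt x / Real.log x) := by
    have h := hX₂ x hxX₂
    rw [pow_one, hsqrt_eq] at h
    have h' : K * Real.log x ≤ 0.005 * Real.sqrt x := by
      have := mul_le_mul_of_nonneg_left h hK0.le
      rwa [← mul_assoc, mul_div_cancel₀ _ hK0.ne'] at this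
    rw [mul_div_assoc', le_div_iff₀ hlx0]
    nlinarith
  have hG2 : LiThetaRH.psiOneErr 2 * w1 2 ≤ |LiThetaRH.psiOneErr 2 * w1 2| * x := by
    have h1 : LiThetaRH.psiOneErr 2 * w1 2 ≤ |LiThetaRH.psiOneErr 2 * w1 2| := le_abs_self _
    exact h1.trans (le_mul_of_one_le_right (abs_nonneg _) (by linarith))
  have hKx : 8.4 * M * x + |LiThetaRH.psiOneErr 2 * w1 2| * x ≤ K * x := by
    rw [hK]; nlinarith
  rw [integral_psi_sub_mul_w1_eq hx2.le]
  linarith [hGx, hBint_le, hbnd, a1, a2, hG2, hKx]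



/-- `log 4 + 4 < 5.39`. [folklore] -/
private theorem log_four_add_four_lt : Real.log 4 + 4 < 5.39 := by
  have := log_four_lt; linarith

/-- **`∫₂ˣ (ψ − θ) w′ ≤ 35 · x^{3/2}/log x`** for large `x` (unconditional: `ψ − θ ≤ 3ψ(√t) ≤ 17√t`,
`w′ ≤ 1/log t`). [cite: MassiasNicolasRobin1988, §5 Lemme B] -/
theorem integral_psi_sub_theta_mul_w1_le :
    ∃ X : ℝ, 2 ≤ X ∧ ∀ x : ℝ, X ≤ x →
      ∫ t in (2:ℝ)..x, (ψ t - θ t) * w1 t ≤ 35 * (x * Real.sqrt x / Real.log x) := by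
  obtain ⟨X₁, hX₁⟩ := exists_log_pow_le 1 (s := 1/2) (ε := 1/25) (by norm_num) (by norm_num)
  refine ⟨max X₁ 16, le_trans (by norm_num) (le_max_right _ _), fun x hx ↦ ?_⟩
  have hxX₁ : X₁ ≤ x := (le_max_left _ _).trans hx
  have hx16 : (16:ℝ) ≤ x := (le_max_right _ _).trans hx
  have hx0 : 0 < x := by linarith
  have hlx0 : 0 < Real.log x := Real.log_pos (by linarith)
  have hsx : 0 < Real.sqrt x := Real.sqrt_pos.2 hx0
  have hsx2 : Real.sqrt x * Real.sqrt x = x := Real.mul_self_sqrt hx0.le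
  set s₀ := Real.sqrt x with hs₀
  have hs4 : (4:ℝ) ≤ s₀ := Real.le_sqrt_of_sq_le (by norm_num; linarith)
  have hs_le : s₀ ≤ x := by nlinarith
  have hlogs : Real.log s₀ = Real.log x / 2 := by rw [hs₀, Real.log_sqrt hx0.le]
  -- the integrand and its pointwise bound
  set g : ℝ → ℝ := fun t ↦ (ψ t - θ t) * w1 t with hg
  have hw1c : ∀ a b : ℝ, 2 ≤ a → ContinuousOn w1 (Set.Icc a b) := fun a b ha ↦
    continuousOn_of_continuousAt (by linarith) fun t ht ↦ continuousAt_w1 ht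
  have hg_int : ∀ a b : ℝ, 2 ≤ a → a ≤ b → IntervalIntegrable g volume a b := by
    intro a b ha hab
    refine ((Chebyshev.psi_mono.intervalIntegrable).sub
      (Chebyshev.theta_mono.intervalIntegrable)).mul_continuousOn ?_
    rw [Set.uIcc_of_le hab]; exact hw1c a b ha
  set bd : ℝ → ℝ := fun t ↦ 17 * (Real.sqrt t / Real.log t) with hbd
  have hbd_int : ∀ a b : ℝ, 2 ≤ a → a ≤ b → IntervalIntegrable bd volume a b := by
    intro a b ha hab
    refine intervalIntegrable_of_continuousAt (by linarith) hab fun t ht ↦ ?_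
    exact continuousAt_const.mul ((Real.continuous_sqrt.continuousAt).div
      (Real.continuousAt_log (by positivity)) (Real.log_pos ht).ne')
  have hgle : ∀ t ∈ Set.Icc 2 x, g t ≤ bd t := by
    intro t ht
    have ht0 : 0 < t := by linarith [ht.1]
    have hlt : 0 < Real.log t := Real.log_pos (by linarith [ht.1])
    have hpt : 0 ≤ ψ t - θ t := by linarith [Chebyshev.theta_le_psi t]
    have hbd0 : 0 ≤ bd t := by simp only [hbd]; positivity
    rcases le_or_gt (Real.exp 1) t with hte | hte
    · -- `ψ − θ ≤ 17 √t`, `0 ≤ w′ ≤ 1/log t`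
      have hw := w1_bounds hte
      have h1 := Chebyshev.psi_sub_theta_le_psi_add_psi_add_psi t
      have ht1 : (1:ℝ) ≤ t := by linarith [ht.1]
      have hr : ∀ k : ℝ, 2 ≤ k → ψ (t ^ k⁻¹) ≤ 5.39 * Real.sqrt t := by
        intro k hk
        have hle : t ^ k⁻¹ ≤ Real.sqrt t := by
          rw [Real.sqrt_eq_rpow]
          exact Real.rpow_le_rpow_of_exponent_le ht1 (by
            rw [inv_le_comm₀ (by linarith) (by norm_num)]; norm_num; exact hk)
        calc ψ (t ^ k⁻¹) ≤ ψ (Real.sqrt t) := Chebyshev.psi_mono hle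
          _ ≤ (Real.log 4 + 4) * Real.sqrt t := Chebyshev.psi_le_const_mul_self (Real.sqrt_nonneg t)
          _ ≤ 5.39 * Real.sqrt t :=
              mul_le_mul_of_nonneg_right log_four_add_four_lt.le (Real.sqrt_nonneg t)
      have h2 := hr 2 le_rfl
      have h3 := hr 3 (by norm_num)
      have h5 := hr 5 (by norm_num)
      have hψθ : ψ t - θ t ≤ 17 * Real.sqrt t := by linarith
      show (ψ t - θ t) * w1 t ≤ 17 * (Real.sqrt t / Real.log t)
      calc (ψ t - θ t) * w1 t ≤ (17 * Real.sqrt t) * (1 / Real.log t) :=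
            mul_le_mul hψθ hw.2 hw.1 (by positivity)
        _ = 17 * (Real.sqrt t / Real.log t) := by ring
    · -- `2 ≤ t < e`: `w′ ≤ 0 ≤ ψ − θ`
      have hlt1 : Real.log t < 1 := by rw [Real.log_lt_iff_lt_exp ht0]; exact hte
      have hw1 : w1 t ≤ 0 := by
        rw [w1]; exact div_nonpos_of_nonpos_of_nonneg (by linarith) (by positivity)
      show (ψ t - θ t) * w1 t ≤ bd t
      nlinarith
  -- integrate over `[2, s₀]` and `[s₀, x]`
  have hl2 := Real.log_two_gt_d9
  have hb1 : ∀ t ∈ Set.Icc 2 s₀, bd t ≤ 25 * Real.sqrt s₀ := by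
    intro t ht
    have hlt : Real.log 2 ≤ Real.log t := Real.log_le_log (by norm_num) ht.1
    have hlt0 : 0 < Real.log t := by linarith
    have e1 : Real.sqrt t / Real.log t ≤ Real.sqrt s₀ / Real.log 2 :=
      (div_le_div_of_nonneg_right (Real.sqrt_le_sqrt ht.2) hlt0.le).trans
        (div_le_div_of_nonneg_left (Real.sqrt_nonneg _) (by linarith) hlt)
    have e2 : Real.sqrt s₀ / Real.log 2 ≤ Real.sqrt s₀ / 0.6931471803 :=
      div_le_div_of_nonneg_left (Real.sqrt_nonneg _) (by norm_num) hl2.le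
    simp only [hbd]
    have hs0 := Real.sqrt_nonneg s₀
    have : Real.sqrt s₀ / 0.6931471803 ≤ 1.45 * Real.sqrt s₀ := by
      rw [div_le_iff₀ (by norm_num)]; nlinarith [Real.sqrt_nonneg s₀]
    linarith
  have hb2 : ∀ t ∈ Set.Icc s₀ x, bd t ≤ 34 * (Real.sqrt x / Real.log x) := by
    intro t ht
    have ht0 : 0 < t := by linarith [ht.1]
    have hlt : Real.log s₀ ≤ Real.log t := Real.log_le_log (by linarith) ht.1
    have hlt0 : 0 < Real.log t := by rw [hlogs] at hlt; linarith
    have e1 : Real.sqrt t / Real.log t ≤ Real.sqrt x / Real.log s₀ :=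
      (div_le_div_of_nonneg_right (Real.sqrt_le_sqrt ht.2) hlt0.le).trans
        (div_le_div_of_nonneg_left (Real.sqrt_nonneg _) (by rw [hlogs]; positivity) hlt)
    rw [hlogs] at e1
    simp only [hbd]
    have e2 : Real.sqrt x / (Real.log x / 2) = 2 * (Real.sqrt x / Real.log x) := by field_simp
    linarith
  have hs2 : (2:ℝ) ≤ s₀ := by linarith
  have hI1 : ∫ t in (2:ℝ)..s₀, bd t ≤ (s₀ - 2) * (25 * Real.sqrt s₀) := by
    have := intervalIntegral.integral_mono_on hs2 (hbd_int 2 s₀ le_rfl hs2)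
      intervalIntegrable_const hb1
    rwa [intervalIntegral.integral_const, smul_eq_mul] at this
  have hI2 : ∫ t in s₀..x, bd t ≤ (x - s₀) * (34 * (Real.sqrt x / Real.log x)) := by
    have := intervalIntegral.integral_mono_on hs_le (hbd_int s₀ x hs2 hs_le)
      intervalIntegrable_const hb2
    rwa [intervalIntegral.integral_const, smul_eq_mul] at this
  have hIadd : ∫ t in (2:ℝ)..x, bd t = (∫ t in (2:ℝ)..s₀, bd t) + ∫ t in s₀..x, bd t :=
    (intervalIntegral.integral_add_adjacent_intervals (hbd_int 2 s₀ le_rfl hs2)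
      (hbd_int s₀ x hs2 hs_le)).symm
  have hmono : ∫ t in (2:ℝ)..x, g t ≤ ∫ t in (2:ℝ)..x, bd t :=
    intervalIntegral.integral_mono_on (by linarith) (hg_int 2 x le_rfl (by linarith))
      (hbd_int 2 x le_rfl (by linarith)) hgle
  -- sizes
  have hss : Real.sqrt s₀ ≤ s₀ := by
    rw [Real.sqrt_le_left (by linarith)]; nlinarith
  have e1 : (s₀ - 2) * (25 * Real.sqrt s₀) ≤ 25 * x := by
    have : (s₀ - 2) * (25 * Real.sqrt s₀) ≤ s₀ * (25 * s₀) := by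
      have h0 : 0 ≤ 25 * Real.sqrt s₀ := by positivity
      nlinarith
    nlinarith
  have e2 : (x - s₀) * (34 * (Real.sqrt x / Real.log x)) ≤ 34 * (x * Real.sqrt x / Real.log x) := by
    have h0 : 0 ≤ 34 * (Real.sqrt x / Real.log x) := by positivity
    have : (x - s₀) * (34 * (Real.sqrt x / Real.log x)) ≤ x * (34 * (Real.sqrt x / Real.log x)) := by
      nlinarith
    have e : x * (34 * (Real.sqrt x / Real.log x)) = 34 * (x * Real.sqrt x / Real.log x) := by ring
    linarith
  have a1 : 25 * x ≤ x * Real.sqrt x / Real.log x := by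
    have h := hX₁ x hxX₁
    rw [pow_one, ← Real.sqrt_eq_rpow] at h
    rw [le_div_iff₀ hlx0]; nlinarith
  linarith [hmono, hIadd, hI1, hI2, e1, e2, a1]

/-- **RH ⟹ `L₂(x) − π₁(x) ≤ 0.75 · x^{3/2}/log x`** for large `x`
(`L₂ − π₁ = Σ_{A₂}(p² − p) ≤ Σ_{p ≤ √(0.505x)} p² ≤ θ(u)u²/log u`). [cite: MassiasNicolasRobin1988, §4 (7) and §6] -/
theorem lTwo_sub_primeSum_le (hRH : RiemannHypothesis) :
    ∃ X : ℝ, ∀ x : ℝ, X ≤ x →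
      lTwo x - primeSum ⌊x⌋₊ ≤ 0.75 * (x * Real.sqrt x / Real.log x) := by
  obtain ⟨U, hU599, hU⟩ := exists_abs_theta_sub_le_small hRH
  refine ⟨max (Real.exp 140) (2 * U ^ 2), fun x hx ↦ ?_⟩
  have hxe : Real.exp 140 ≤ x := (le_max_left _ _).trans hx
  have hxU2 : 2 * U ^ 2 ≤ x := (le_max_right _ _).trans hx
  have hx0 : 0 < x := (Real.exp_pos _).trans_le hxe
  have hlx : 140 ≤ Real.log x := by rw [Real.le_log_iff_exp_le hx0]; exact hxe
  have hlx0 : 0 < Real.log x := by linarith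
  have hsx : 0 < Real.sqrt x := Real.sqrt_pos.2 hx0
  have hsx2 : Real.sqrt x * Real.sqrt x = x := Real.mul_self_sqrt hx0.le
  set u := Real.sqrt (0.505 * x) with hu
  have huU : U ≤ u := Real.le_sqrt_of_sq_le (by nlinarith)
  have hu2 : (2:ℝ) ≤ u := by linarith
  have hu0 : 0 < u := by linarith
  have husq : u ^ 2 = 0.505 * x := Real.sq_sqrt (by positivity)
  have hule : u ≤ 0.7107 * Real.sqrt x := by
    rw [hu, Real.sqrt_le_iff]; constructor
    · positivity
    · nlinarith
  have hux : u ≤ x := by nlinarith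
  -- `L₂ − π₁ ≤ Σ_{p ≤ u} p²`
  have hstep : lTwo x - primeSum ⌊x⌋₊ ≤ ∑ p ∈ Nat.primesLE ⌊u⌋₊, ((p:ℝ) ^ 2) := by
    rw [lTwo, primeSum]
    push_cast
    rw [← Finset.sum_sub_distrib]
    have h1 : ∀ p ∈ Nat.primesLE ⌊x⌋₊,
        powOr0 p (expo x p) - (p:ℝ) ≤ if p ≤ ⌊u⌋₊ then ((p:ℝ) ^ 2) else 0 := by
      intro p hp
      obtain ⟨hpx, hpp⟩ := Nat.mem_primesLE.1 hp
      have hpxr : (p:ℝ) ≤ x := (Nat.cast_le.2 hpx).trans (Nat.floor_le hx0.le)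
      have hp0 : (0:ℝ) ≤ p := Nat.cast_nonneg p
      by_cases hA : (p:ℝ) ^ 2 - p ≤ rho x * Real.log p
      · have he : expo x p = 2 := by unfold expo; rw [if_pos hpxr, if_pos hA]
        have hpu : p ≤ ⌊u⌋₊ := Nat.le_floor (le_sqrt_of_inA2 hxe hpp hpxr hA)
        rw [he, powOr0, if_neg two_ne_zero, if_pos hpu]; linarith
      · have he : expo x p = 1 := by unfold expo; rw [if_pos hpxr, if_neg hA]
        rw [he, powOr0, if_neg one_ne_zero, pow_one, sub_self]
        split_ifs <;> positivity
    calc ∑ p ∈ Nat.primesLE ⌊x⌋₊, (powOr0 p (expo x p) - (p:ℝ))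
        ≤ ∑ p ∈ Nat.primesLE ⌊x⌋₊, (if p ≤ ⌊u⌋₊ then ((p:ℝ) ^ 2) else 0) := Finset.sum_le_sum h1
      _ = ∑ p ∈ (Nat.primesLE ⌊x⌋₊).filter (· ≤ ⌊u⌋₊), ((p:ℝ) ^ 2) := by rw [Finset.sum_filter]
      _ ≤ ∑ p ∈ Nat.primesLE ⌊u⌋₊, ((p:ℝ) ^ 2) := by
          refine Finset.sum_le_sum_of_subset_of_nonneg (fun p hp ↦ ?_) (fun p _ _ ↦ by positivity)
          rw [Finset.mem_filter, Nat.mem_primesLE] at hp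
          exact Nat.mem_primesLE.2 ⟨hp.2, hp.1.2⟩
  -- `Σ_{p ≤ u} p² ≤ θ(u) u²/log u ≤ 1.001 u³/log u`
  have hS2 : ∑ p ∈ Nat.primesLE ⌊u⌋₊, ((p:ℝ) ^ 2) ≤ 1.001 * u * (u ^ 2 / Real.log u) := by
    rw [sum_sq_eq hu2]
    have hlu0 : 0 < Real.log u := Real.log_pos (by linarith)
    have hint : 0 ≤ ∫ t in (2:ℝ)..u, θ t * f2d t := by
      refine intervalIntegral.integral_nonneg hu2 fun t ht ↦ mul_nonneg (Chebyshev.theta_nonneg t) ?_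
      have hlt : Real.log 2 ≤ Real.log t := Real.log_le_log (by norm_num) ht.1
      have := Real.log_two_gt_d9
      rw [f2d]; apply div_nonneg _ (by positivity); nlinarith [ht.1]
    have hθu : θ u ≤ 1.001 * u := by
      have h1 := (abs_le.1 (hU u huU)).2; linarith
    have hf2 : 0 ≤ f2 u := by rw [f2]; positivity
    have : θ u * f2 u ≤ 1.001 * u * f2 u := mul_le_mul_of_nonneg_right hθu hf2
    rw [f2] at this ⊢
    linarith
  -- `u³/log u ≤ 0.74 Q`
  have hl2 := Real.log_two_lt_d9
  have hlu : 0.49 * Real.log x ≤ Real.log u := by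
    have h1 : Real.log (Real.sqrt (0.5 * x)) ≤ Real.log u :=
      Real.log_le_log (Real.sqrt_pos.2 (by positivity)) (Real.sqrt_le_sqrt (by nlinarith))
    have h2 : Real.log (Real.sqrt (0.5 * x)) = (Real.log x - Real.log 2) / 2 := by
      rw [Real.log_sqrt (by positivity), Real.log_mul (by norm_num) hx0.ne',
        show (0.5:ℝ) = 2⁻¹ by norm_num, Real.log_inv]; ring
    rw [h2] at h1
    linarith
  have hlu0 : 0 < Real.log u := by linarith
  have hQ : 1.001 * u * (u ^ 2 / Real.log u) ≤ 0.75 * (x * Real.sqrt x / Real.log x) := by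
    have e1 : 1.001 * u * (u ^ 2 / Real.log u) = 1.001 * (u ^ 2 * u) / Real.log u := by ring
    rw [e1, husq, mul_div_assoc', div_le_div_iff₀ hlu0 hlx0]
    have h1 : 1.001 * (0.505 * x * u) * Real.log x ≤ 1.001 * (0.505 * x * (0.7107 * Real.sqrt x)) * Real.log x := by
      have := mul_le_mul_of_nonneg_left hule (by positivity : (0:ℝ) ≤ 1.001 * (0.505 * x) * Real.log x)
      nlinarith
    have h2 : 0.75 * (x * Real.sqrt x) * (0.49 * Real.log x) ≤ 0.75 * (x * Real.sqrt x) * Real.log u :=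
      mul_le_mul_of_nonneg_left hlu (by positivity)
    have hM : 0 ≤ x * Real.sqrt x * Real.log x := by positivity
    linarith
  linarith

set_option maxHeartbeats 400000 in
/-- **RH ⟹ `L₂(x) ≤ li(T(x)²) + 36 · x^{3/2}/log x`** for large `x` (with the side facts used
downstream: `θ(x) ≥ e`, `0.999x ≤ θ(x)`, `T(x) ≤ 1.002x`, `2(x+1) ≤ x^{3/2}/log x`).
[cite: MassiasNicolasRobin1988, §6 (Li(log² N_ρ) vs ℓ(N_ρ))] -/
theorem lTwo_le_logIntegral_bigT_sq (hRH : RiemannHypothesis) :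
    ∃ X : ℝ, 4 ≤ X ∧ ∀ x : ℝ, X ≤ x →
      lTwo x ≤ logIntegral (bigT x ^ 2) + 36 * (x * Real.sqrt x / Real.log x) ∧
        Real.exp 1 ≤ θ x ∧ 0.999 * x ≤ θ x ∧ bigT x ≤ 1.002 * x ∧
        2 * (x + 1) ≤ x * Real.sqrt x / Real.log x := by
  obtain ⟨U, hU599, hU⟩ := exists_abs_theta_sub_le_small hRH
  obtain ⟨X₄, hX₄2, h4⟩ := integral_psi_sub_mul_w1_ge hRH
  obtain ⟨X₅, hX₅2, h5⟩ := integral_psi_sub_theta_mul_w1_le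
  obtain ⟨X₆, h6⟩ := lTwo_sub_primeSum_le hRH
  obtain ⟨X₁, hX₁⟩ := exists_log_pow_le 1 (s := 1/2) (ε := 1/40) (by norm_num) (by norm_num)
  refine ⟨max (max (max X₄ X₅) (max X₆ X₁)) (max (Real.exp 1000) (2 * U ^ 2)),
    le_trans (by have := Real.add_one_le_exp (1000:ℝ); linarith)
      ((le_max_left _ _).trans (le_max_right _ _)), fun x hx ↦ ?_⟩
  have hx4 : X₄ ≤ x := (((le_max_left _ _).trans (le_max_left _ _)).trans (le_max_left _ _)).trans hx
  have hx5 : X₅ ≤ x := (((le_max_right _ _).trans (le_max_left _ _)).trans (le_max_left _ _)).trans hx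
  have hx6 : X₆ ≤ x := (((le_max_left _ _).trans (le_max_right _ _)).trans (le_max_left _ _)).trans hx
  have hx1 : X₁ ≤ x := (((le_max_right _ _).trans (le_max_right _ _)).trans (le_max_left _ _)).trans hx
  have hxe : Real.exp 1000 ≤ x := ((le_max_left _ _).trans (le_max_right _ _)).trans hx
  have hxU2 : 2 * U ^ 2 ≤ x := ((le_max_right _ _).trans (le_max_right _ _)).trans hx
  have hx0 : 0 < x := (Real.exp_pos _).trans_le hxe
  have hlx : 1000 ≤ Real.log x := by rw [Real.le_log_iff_exp_le hx0]; exact hxe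
  have hlx0 : 0 < Real.log x := by linarith
  have hxU : U ≤ x := by nlinarith
  have hx140 : Real.exp 140 ≤ x := le_trans (Real.exp_le_exp.2 (by norm_num)) hxe
  have hx2 : (2:ℝ) ≤ x := by linarith
  have hsx : 0 < Real.sqrt x := Real.sqrt_pos.2 hx0
  have hsx2 : Real.sqrt x * Real.sqrt x = x := Real.mul_self_sqrt hx0.le
  -- θ(x), T(x)
  have hθ1 := abs_le.1 (hU x hxU)
  have hθlo : 0.999 * x ≤ θ x := by linarith [hθ1.1]
  have hθhi : θ x ≤ 1.001 * x := by linarith [hθ1.2]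
  have he3 : Real.exp 1 < 3 := by have := Real.exp_one_lt_d9; linarith
  have hxbig : (506090:ℝ) ≤ x := by have := Real.add_one_le_exp (1000:ℝ); nlinarith [hU599]
  have hθe : Real.exp 1 ≤ θ x := by linarith
  set u := Real.sqrt (0.505 * x) with hu
  have huU : U ≤ u := Real.le_sqrt_of_sq_le (by nlinarith)
  have hule : u ≤ 0.71064 * Real.sqrt x := by
    rw [hu, Real.sqrt_le_iff]; constructor
    · positivity
    · nlinarith
  have hθu : θ u ≤ 1.001 * u := by have h1 := (abs_le.1 (hU u huU)).2; linarith
  have hTθ : bigT x - θ x ≤ 0.7114 * Real.sqrt x := by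
    have := bigT_sub_theta_le hx140
    rw [← hu] at this
    nlinarith [Real.sqrt_nonneg x]
  have hT0 : θ x ≤ bigT x := theta_le_bigT hx0.le
  have hsx_small : 0.7114 * Real.sqrt x ≤ 0.001 * x := by
    have h1 : (711.4:ℝ) ≤ Real.sqrt x := Real.le_sqrt_of_sq_le (by nlinarith)
    nlinarith [h1, hsx2, hsx]
  have hThi : bigT x ≤ 1.002 * x := by linarith
  have hTe : Real.exp 1 ≤ bigT x := hθe.trans hT0
  -- the pieces
  have hP1 : 0 ≤ liSq (bigT x) - liSq (θ x) := by
    have := mul_div_log_le_liSq_sub hθe hTe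
    have h0 : 0 ≤ (bigT x - θ x) * (θ x / Real.log (θ x)) :=
      mul_nonneg (by linarith) (div_nonneg (by linarith) (Real.log_nonneg (by linarith)))
    linarith
  have hex : Real.exp 1 ≤ x := by linarith
  have htan : (θ x - x) * (x / Real.log x) ≤ liSq (θ x) - liSq x := mul_div_log_le_liSq_sub hex hθe
  have hid := primeSum_sub_liSq_eq hx2
  have hw1c : ContinuousOn w1 (Set.uIcc 2 x) := by
    rw [Set.uIcc_of_le hx2]
    exact continuousOn_of_continuousAt one_lt_two fun t ht ↦ continuousAt_w1 ht
  have hA : IntervalIntegrable (fun t ↦ (ψ t - t) * w1 t) volume 2 x :=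
    ((Chebyshev.psi_mono.intervalIntegrable).sub (continuous_id.intervalIntegrable _ _)).mul_continuousOn hw1c
  have hB : IntervalIntegrable (fun t ↦ (ψ t - θ t) * w1 t) volume 2 x :=
    ((Chebyshev.psi_mono.intervalIntegrable).sub (Chebyshev.theta_mono.intervalIntegrable)).mul_continuousOn hw1c
  have hsplit : ∫ t in (2:ℝ)..x, (θ t - t) * w1 t
      = (∫ t in (2:ℝ)..x, (ψ t - t) * w1 t) - ∫ t in (2:ℝ)..x, (ψ t - θ t) * w1 t := by
    rw [← intervalIntegral.integral_sub hA hB]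
    refine intervalIntegral.integral_congr fun t _ ↦ ?_
    show _ = _ - _; ring
  have hI1 := h4 x hx4
  have hI2 := h5 x hx5
  have hP3 := h6 x hx6
  have hw2 : w 2 ≤ 3 := by
    rw [w, div_le_iff₀ (Real.log_pos one_lt_two)]
    have := Real.log_two_gt_d9; linarith
  have hli : liSq (bigT x) + logIntegral 4 = logIntegral (bigT x ^ 2) :=
    (logIntegral_sq_eq (by linarith)).symm
  have hli4 : 0 < logIntegral 4 := logIntegral_four_pos
  -- absorb `2 w(2) ≤ 6 ≤ 0.19 Q` and `2(x+1) ≤ Q`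
  have hQx : 40 * x ≤ x * Real.sqrt x / Real.log x := by
    have h := hX₁ x hx1
    rw [pow_one, ← Real.sqrt_eq_rpow] at h
    rw [le_div_iff₀ hlx0]
    have := mul_le_mul_of_nonneg_left h (by positivity : (0:ℝ) ≤ 40 * x)
    linarith
  have hwx : w x = x / Real.log x := rfl
  refine ⟨?_, hθe, hθlo, hThi, by linarith⟩
  rw [hwx] at hid
  linarith [hP1, htan, hid, hsplit, hI1, hI2, hP3, hw2, hli, hli4, hQx]


/-! ## §11 The jump of `L₂` between consecutive integers, and MNR Thm 1 (i) under RH (lower half) -/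

/-- the first-order function `F(p) = (p² − p)/log p` deciding membership in `A₂`. [folklore] -/
private noncomputable def fF (p : ℕ) : ℝ := ((p:ℝ) ^ 2 - p) / Real.log p

/-- `F` increases by at least `1` between consecutive primes. [folklore] -/
private theorem fF_add_one_le {p q : ℕ} (hp : p.Prime) (hq : q.Prime) (hpq : p < q) :
    fF p + 1 ≤ fF q := by
  have hp2 := hp.two_le
  have hp2r : (2:ℝ) ≤ p := by exact_mod_cast hp2
  have hq3 : 3 ≤ q := by omega
  have hq3r : (3:ℝ) ≤ q := by exact_mod_cast hq3
  have hlp : 0 < Real.log p := Real.log_pos (by linarith)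
  have hlq : 0 < Real.log q := Real.log_pos (by linarith)
  have hl2 := Real.log_two_gt_d9
  have hl2' := Real.log_two_lt_d9
  -- `F(q) ≥ q` always
  have hFq : (q:ℝ) ≤ fF q := by
    rw [fF, le_div_iff₀ hlq]
    have := Real.log_le_sub_one_of_pos (show (0:ℝ) < q by linarith)
    nlinarith
  rcases Nat.lt_or_ge p 3 with hp3 | hp3
  · -- `p = 2`
    have hp2' : p = 2 := by omega
    subst hp2'
    have hF2 : fF 2 ≤ 2.9 := by
      rw [fF, div_le_iff₀ hlp]; push_cast; nlinarith
    rcases Nat.lt_or_ge q 4 with hq4 | hq4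
    · have hq3' : q = 3 := by omega
      subst hq3'
      -- `F(3) = 6/log 3 ≥ 6/log 4`
      have hl3 : Real.log (3:ℝ) ≤ 1.3863 := by
        have h4 : Real.log 4 < 1.3863 := log_four_lt
        have : Real.log (3:ℝ) ≤ Real.log 4 := Real.log_le_log (by norm_num) (by norm_num)
        linarith
      have hF3 : 3.9 ≤ fF 3 := by
        rw [fF, le_div_iff₀ hlq]; push_cast
        have hl30 : 0 < Real.log (3:ℝ) := Real.log_pos (by norm_num)
        nlinarith
      linarith
    · have : (4:ℝ) ≤ q := by exact_mod_cast hq4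
      linarith
  · -- `p ≥ 3`: `F(q) = (q − 1)(q/log q) ≥ p · (p/log p) = F(p) + p/log p ≥ F(p) + 1`
    have hp3r : (3:ℝ) ≤ p := by exact_mod_cast hp3
    have he3 : Real.exp 1 ≤ (p:ℝ) := le_trans (by have := Real.exp_one_lt_d9; linarith) hp3r
    have hpq' : (p:ℝ) + 1 ≤ q := by exact_mod_cast hpq
    have hmono := div_log_mono he3 (show (p:ℝ) ≤ q by linarith)
    have h1 : fF q = ((q:ℝ) - 1) * ((q:ℝ) / Real.log q) := by rw [fF]; ring
    have h2 : fF p + (p:ℝ) / Real.log p = (p:ℝ) * ((p:ℝ) / Real.log p) := by rw [fF]; ring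
    have h3 : (p:ℝ) * ((p:ℝ) / Real.log p) ≤ ((q:ℝ) - 1) * ((q:ℝ) / Real.log q) :=
      mul_le_mul (by linarith) hmono (by positivity) (by linarith)
    have h4 : 1 ≤ (p:ℝ) / Real.log p := by
      rw [le_div_iff₀ hlp]
      have := Real.log_le_sub_one_of_pos (show (0:ℝ) < p by linarith); linarith
    linarith

/-- `ρ(m+1) ≤ ρ(m) + 1` for `m ≥ 3`. [folklore] -/
private theorem rho_succ_le {x : ℝ} (hx : Real.exp 1 ≤ x) : rho (x + 1) ≤ rho x + 1 := by
  have hx0 : 0 < x := (Real.exp_pos 1).trans_le hx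
  have hl : 1 ≤ Real.log x := by rw [Real.le_log_iff_exp_le hx0]; exact hx
  have hl' : Real.log x ≤ Real.log (x + 1) := Real.log_le_log hx0 (by linarith)
  rw [rho, rho]
  calc (x + 1) / Real.log (x + 1) ≤ (x + 1) / Real.log x :=
        div_le_div_of_nonneg_left (by linarith) (by linarith) hl'
    _ = x / Real.log x + 1 / Real.log x := by ring
    _ ≤ x / Real.log x + 1 := by
        have : 1 / Real.log x ≤ 1 := by rw [div_le_iff₀ (by linarith)]; linarith
        linarith

/-- the primes `≤ m+1` are the primes `≤ m`, plus `m + 1` if it is prime. [folklore] -/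
private theorem sum_primesLE_succ (m : ℕ) (f : ℕ → ℝ) :
    ∑ p ∈ Nat.primesLE (m + 1), f p
      = (if (m + 1).Prime then f (m + 1) else 0) + ∑ p ∈ Nat.primesLE m, f p := by
  have h : Nat.primesLE (m + 1)
      = if (m + 1).Prime then insert (m + 1) (Nat.primesLE m) else Nat.primesLE m := by
    rw [Nat.primesLE, Nat.primesBelow,
      show Finset.range (m + 1 + 1) = insert (m + 1) (Finset.range (m + 1)) from Finset.range_add_one,
      Finset.filter_insert]
    rfl
  have hnot : m + 1 ∉ Nat.primesLE m := fun h' ↦ by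
    have := (Nat.mem_primesLE.1 h').1; omega
  rw [h]
  split_ifs with hpr
  · rw [Finset.sum_insert hnot]
  · simp

/-- **The jump of `L₂` at consecutive integers**: `L₂(m+1) − L₂(m) ≤ 2(m+1)` for `m ≥ e^{140}`
(the new prime `m+1` contributes `m+1`; at most ONE prime enters the second layer, since
`F(p) = (p² − p)/log p` has gaps `≥ 1 ≥ ρ(m+1) − ρ(m)`, and it contributes `≤ 0.505(m+1)`).
[cite: MassiasNicolasRobin1988, §4 (10) (N' ≤ P₁ N for consecutive elements of G)] -/
theorem lTwo_succ_sub_le {m : ℕ} (hm : Real.exp 140 ≤ (m:ℝ)) :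
    lTwo ((m:ℝ) + 1) - lTwo (m:ℝ) ≤ 2 * ((m:ℝ) + 1) := by
  have hm3 : (320000:ℝ) ≤ m := exp_140_ge.trans hm
  have hm0 : (0:ℝ) < m := by linarith
  have hme : Real.exp 1 ≤ (m:ℝ) := le_trans (Real.exp_le_exp.2 (by norm_num)) hm
  have hm1e : Real.exp 140 ≤ (m:ℝ) + 1 := by linarith
  have hfl : ⌊(m:ℝ) + 1⌋₊ = m + 1 := by
    rw [show (m:ℝ) + 1 = ((m + 1 : ℕ) : ℝ) by push_cast; ring, Nat.floor_natCast]
  have hfl0 : ⌊(m:ℝ)⌋₊ = m := Nat.floor_natCast m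
  rw [lTwo, lTwo, hfl, hfl0, sum_primesLE_succ, add_sub_assoc, ← Finset.sum_sub_distrib]
  -- the new prime
  have hnew : (if (m + 1).Prime then powOr0 (m + 1) (expo ((m:ℝ) + 1) (m + 1)) else 0) ≤ (m:ℝ) + 1 := by
    split_ifs with hpr
    · have hcast : (((m + 1 : ℕ) : ℝ)) = (m:ℝ) + 1 := by push_cast; ring
      have hnotA : ¬ ((((m+1:ℕ):ℝ)) ^ 2 - ((m+1:ℕ):ℝ) ≤ rho ((m:ℝ) + 1) * Real.log ((m+1:ℕ):ℝ)) := by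
        rw [hcast, rho, div_mul_cancel₀ _ (Real.log_pos (by linarith)).ne']
        nlinarith
      have he : expo ((m:ℝ) + 1) (m + 1) = 1 := by
        unfold expo; rw [if_pos (by rw [hcast]), if_neg hnotA]
      rw [he, powOr0, if_neg one_ne_zero, pow_one, hcast]
    · linarith
  -- the old primes: only entering primes contribute
  set A : ℝ → ℕ → Prop := fun x p ↦ (p:ℝ) ^ 2 - p ≤ rho x * Real.log p with hA
  have hρ : rho (m:ℝ) ≤ rho ((m:ℝ) + 1) := div_log_mono hme (by linarith)
  set E := (Nat.primesLE m).filter (fun p ↦ ¬ A (m:ℝ) p ∧ A ((m:ℝ) + 1) p) with hE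
  have hold : ∀ p ∈ Nat.primesLE m,
      powOr0 p (expo ((m:ℝ) + 1) p) - powOr0 p (expo (m:ℝ) p)
        = if (¬ A (m:ℝ) p ∧ A ((m:ℝ) + 1) p) then ((p:ℝ) ^ 2 - p) else 0 := by
    intro p hp
    obtain ⟨hpm, hpp⟩ := Nat.mem_primesLE.1 hp
    have hpmr : (p:ℝ) ≤ m := by exact_mod_cast hpm
    have hpm1 : (p:ℝ) ≤ (m:ℝ) + 1 := by linarith
    have hlp : 0 ≤ Real.log p := Real.log_nonneg (by exact_mod_cast hpp.one_lt.le)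
    by_cases h1 : A (m:ℝ) p
    · have h2 : A ((m:ℝ) + 1) p := le_trans h1 (mul_le_mul_of_nonneg_right hρ hlp)
      have e1 : expo (m:ℝ) p = 2 := by unfold expo; rw [if_pos hpmr, if_pos h1]
      have e2 : expo ((m:ℝ) + 1) p = 2 := by unfold expo; rw [if_pos hpm1, if_pos h2]
      rw [e1, e2, if_neg (fun h ↦ h.1 h1), sub_self]
    · have e1 : expo (m:ℝ) p = 1 := by unfold expo; rw [if_pos hpmr, if_neg h1]
      by_cases h2 : A ((m:ℝ) + 1) p
      · have e2 : expo ((m:ℝ) + 1) p = 2 := by unfold expo; rw [if_pos hpm1, if_pos h2]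
        rw [e1, e2, if_pos ⟨h1, h2⟩, powOr0, powOr0, if_neg two_ne_zero, if_neg one_ne_zero, pow_one]
      · have e2 : expo ((m:ℝ) + 1) p = 1 := by unfold expo; rw [if_pos hpm1, if_neg h2]
        rw [e1, e2, if_neg (fun h ↦ h2 h.2), sub_self]
  rw [Finset.sum_congr rfl hold, ← Finset.sum_filter]
  -- at most one entering prime
  have hcard : E.card ≤ 1 := by
    rw [Finset.card_le_one]
    intro a ha b hb
    by_contra hab
    rw [hE, Finset.mem_filter, Nat.mem_primesLE] at ha hb
    -- wlog `a < b`
    have key : ∀ p q : ℕ, p.Prime → q.Prime → p < q → ¬ A (m:ℝ) p → A ((m:ℝ) + 1) q → False := by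
      intro p q hp hq hpq hnp hAq
      have hlp : 0 < Real.log p := Real.log_pos (by exact_mod_cast hp.one_lt)
      have hlq : 0 < Real.log q := Real.log_pos (by exact_mod_cast hq.one_lt)
      have h1 : rho (m:ℝ) < fF p := by
        rw [fF, lt_div_iff₀ hlp]; simp only [hA] at hnp; push Not at hnp; linarith
      have h2 : fF q ≤ rho ((m:ℝ) + 1) := by
        rw [fF, div_le_iff₀ hlq]; exact hAq
      have h3 := fF_add_one_le hp hq hpq
      have h4 := rho_succ_le hme
      linarith
    rcases lt_or_gt_of_ne hab with h | h
    · exact key a b ha.1.2 hb.1.2 h ha.2.1 hb.2.2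
    · exact key b a hb.1.2 ha.1.2 h hb.2.1 ha.2.2
  -- each entering prime contributes `≤ 0.505 (m+1)`
  have hle : ∀ p ∈ E, ((p:ℝ) ^ 2 - p) ≤ 0.505 * ((m:ℝ) + 1) := by
    intro p hp
    rw [hE, Finset.mem_filter, Nat.mem_primesLE] at hp
    have hpp := hp.1.2
    have hpm1 : (p:ℝ) ≤ (m:ℝ) + 1 := by have := hp.1.1; exact_mod_cast Nat.le_succ_of_le this
    have h1 := le_sqrt_of_inA2 hm1e hpp hpm1 hp.2.2
    have h2 : (p:ℝ) ^ 2 ≤ 0.505 * ((m:ℝ) + 1) := by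
      calc (p:ℝ) ^ 2 ≤ Real.sqrt (0.505 * ((m:ℝ) + 1)) ^ 2 := pow_le_pow_left₀ (Nat.cast_nonneg p) h1 2
        _ = 0.505 * ((m:ℝ) + 1) := Real.sq_sqrt (by positivity)
    have hp0 : (0:ℝ) ≤ p := Nat.cast_nonneg p
    linarith
  have hsumE : ∑ p ∈ E, ((p:ℝ) ^ 2 - p) ≤ 0.505 * ((m:ℝ) + 1) := by
    have h1 := Finset.sum_le_card_nsmul E (fun p ↦ ((p:ℝ) ^ 2 - p)) _ hle
    rw [nsmul_eq_mul] at h1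
    have h2 : (E.card : ℝ) * (0.505 * ((m:ℝ) + 1)) ≤ 1 * (0.505 * ((m:ℝ) + 1)) :=
      mul_le_mul_of_nonneg_right (by exact_mod_cast hcard) (by positivity)
    linarith
  have hEeq : (Nat.primesLE m).filter (fun p ↦ ¬ A (m:ℝ) p ∧ A ((m:ℝ) + 1) p) = E := rfl
  rw [hEeq]
  linarith


/-- crude size bound `L₂(k) ≤ (k+1)³`. [folklore] -/
private theorem lTwo_le_cube (k : ℕ) : lTwo (k:ℝ) ≤ ((k:ℝ) + 1) ^ 3 := by
  rw [lTwo, Nat.floor_natCast]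
  have hk0 : (0:ℝ) ≤ k := Nat.cast_nonneg k
  have h1 : ∀ p ∈ Nat.primesLE k, powOr0 p (expo (k:ℝ) p) ≤ (k:ℝ) ^ 2 := by
    intro p hp
    obtain ⟨hpk, hpp⟩ := Nat.mem_primesLE.1 hp
    have hpkr : (p:ℝ) ≤ k := by exact_mod_cast hpk
    have hp1 : (1:ℝ) ≤ p := by exact_mod_cast hpp.one_lt.le
    have h2 := expo_le_two (k:ℝ) p
    unfold powOr0
    split_ifs with h
    · positivity
    · interval_cases he : expo (k:ℝ) p
      · exact absurd rfl h
      · rw [pow_one]; nlinarith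
      · nlinarith
  have hcard : ((Nat.primesLE k).card : ℝ) ≤ k + 1 := by
    have h1 : (Nat.primesLE k).card ≤ k + 1 := by
      rw [Nat.primesLE, Nat.primesBelow]
      exact (Finset.card_filter_le _ _).trans (by simp)
    exact_mod_cast h1
  calc ∑ p ∈ Nat.primesLE k, powOr0 p (expo (k:ℝ) p) ≤ ∑ p ∈ Nat.primesLE k, (k:ℝ) ^ 2 :=
        Finset.sum_le_sum h1
    _ = (Nat.primesLE k).card * (k:ℝ) ^ 2 := by rw [Finset.sum_const, nsmul_eq_mul]
    _ ≤ ((k:ℝ) + 1) * (k:ℝ) ^ 2 := mul_le_mul_of_nonneg_right hcard (by positivity)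
    _ ≤ ((k:ℝ) + 1) ^ 3 := by nlinarith

/-- **MNR 1988, Thm. 1 (i) under RH (lower half): `log g(n) ≥ √(li⁻¹(n)) − 38 (li⁻¹(n))^{1/4}` for
large `n`** (MNR: `log g(n) = √(Li⁻¹(n)) + O((n log n)^{θ/2})` for `θ < 1`; under RH `θ = 1/2` and
`(n log n)^{1/4} ≍ (li⁻¹ n)^{1/4}`; the upper half is Thm. 1 (iv)). Route: `N_ρ ∈ g(ℕ)` with
`ℓ(N_ρ) = L₂(m) ≤ n < L₂(m+1) ≤ L₂(m) + 2(m+1)` and `L₂(m) ≤ li(T(m)²) + 36 m^{3/2}/log m`, then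
the tangent to `t ↦ li(t²)` at `T(m)`.
[cite: MassiasNicolasRobin1988, Thm. 1 (i) (θ = 1/2 under RH) and §6] -/
theorem sqrt_sub_rpow_le_log_landauFn_of_riemannHypothesis (hRH : RiemannHypothesis) :
    ∃ n₀ : ℕ, ∀ n : ℕ, n₀ ≤ n → ∀ y : ℝ, 1 < y → logIntegral y = n →
      Real.sqrt y - 38 * y ^ ((1:ℝ)/4) ≤ Real.log (landauFn n) := by
  classical
  obtain ⟨X, hX4, hX⟩ := lTwo_le_logIntegral_bigT_sq hRH
  set X' : ℝ := max X (Real.exp 140) with hX'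
  refine ⟨⌈(X' + 2) ^ 3⌉₊, fun n hn y hy hyn ↦ ?_⟩
  have hX'X : X ≤ X' := le_max_left _ _
  have hX'e : Real.exp 140 ≤ X' := le_max_right _ _
  have hX'0 : 0 < X' := lt_of_lt_of_le (Real.exp_pos 140) hX'e
  have hn' : (X' + 2) ^ 3 ≤ n := (Nat.le_ceil _).trans (by exact_mod_cast hn)
  -- choose `m` maximal with `L₂(m) ≤ n`
  set P : ℕ → Prop := fun m ↦ lTwo (m:ℝ) ≤ n with hP
  set m := Nat.findGreatest P (2 * n + 2) with hmdef
  have hP0 : P 0 := by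
    show lTwo ((0:ℕ):ℝ) ≤ n
    rw [lTwo, Nat.cast_zero, Nat.floor_zero, Nat.primesLE_zero, Finset.sum_empty]
    exact Nat.cast_nonneg n
  have hPm : P m := Nat.findGreatest_spec (Nat.zero_le _) hP0
  have hnotB : ¬ P (2 * n + 2) := by
    obtain ⟨q, hq, hq1, hq2⟩ := Nat.exists_prime_lt_and_le_two_mul (n + 1) (by omega)
    show ¬ (lTwo (((2 * n + 2 : ℕ)) : ℝ) ≤ n)
    push Not
    have hqmem : q ∈ Nat.primesLE ⌊((2 * n + 2 : ℕ) : ℝ)⌋₊ := by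
      rw [Nat.floor_natCast, Nat.mem_primesLE]; exact ⟨by omega, hq⟩
    have hqx : (q:ℝ) ≤ ((2 * n + 2 : ℕ) : ℝ) := by exact_mod_cast (show q ≤ 2 * n + 2 by omega)
    have hq1' : (1:ℝ) ≤ q := by exact_mod_cast hq.one_lt.le
    calc (n:ℝ) < q := by exact_mod_cast (show n < q by omega)
      _ ≤ powOr0 q (expo (((2 * n + 2 : ℕ) : ℝ)) q) := by
          have h1 := one_le_expo hqx
          have h2 := expo_le_two (((2 * n + 2 : ℕ) : ℝ)) q
          interval_cases h : expo (((2 * n + 2 : ℕ) : ℝ)) q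
          · rw [powOr0, if_neg one_ne_zero, pow_one]
          · rw [powOr0, if_neg two_ne_zero]; nlinarith
      _ ≤ lTwo (((2 * n + 2 : ℕ) : ℝ)) := by
          rw [lTwo]
          refine Finset.single_le_sum (f := fun p ↦ powOr0 p (expo (((2 * n + 2 : ℕ) : ℝ)) p))
            (fun p _ ↦ ?_) hqmem
          unfold powOr0; split_ifs <;> positivity
  have hm_le : m ≤ 2 * n + 2 := Nat.findGreatest_le (2 * n + 2)
  have hm_lt : m < 2 * n + 2 := by
    rcases hm_le.lt_or_eq with h | h
    · exact h
    · exact absurd (h ▸ hPm) hnotB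
  have hnotP : ¬ P (m + 1) := Nat.findGreatest_is_greatest (Nat.lt_succ_self m) hm_lt
  have hPm' : lTwo (m:ℝ) ≤ n := hPm
  have hnotP' : (n:ℝ) < lTwo ((m:ℝ) + 1) := by
    have : ¬ (lTwo (((m + 1 : ℕ)) : ℝ) ≤ n) := hnotP
    push Not at this
    have hcast : (((m + 1 : ℕ)) : ℝ) = (m:ℝ) + 1 := by push_cast; ring
    rwa [hcast] at this
  -- `m` is large
  have hm_big : X' < m := by
    by_contra h
    push Not at h
    have h1 := lTwo_le_cube (m + 1)
    have hcast : (((m + 1 : ℕ)) : ℝ) = (m:ℝ) + 1 := by push_cast; ring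
    rw [hcast] at h1
    have hm0 : (0:ℝ) ≤ m := Nat.cast_nonneg m
    have h2 : ((m:ℝ) + 1 + 1) ^ 3 ≤ (X' + 2) ^ 3 := by
      apply pow_le_pow_left₀ (by positivity); linarith
    linarith
  have hmX : X ≤ (m:ℝ) := hX'X.trans hm_big.le
  have hme : Real.exp 140 ≤ (m:ℝ) := hX'e.trans hm_big.le
  have hm0 : (0:ℝ) ≤ m := Nat.cast_nonneg m
  obtain ⟨hmain, hθe, hθlo, hThi, h2Q⟩ := hX (m:ℝ) hmX
  have hjump := lTwo_succ_sub_le hme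
  -- `T(m) ≤ log g(n)`
  have hT := bigT_le_log_landauFn hm0 hPm'
  set T := bigT (m:ℝ) with hTdef
  set Q := (m:ℝ) * Real.sqrt m / Real.log m with hQdef
  have hli : (n:ℝ) < logIntegral (T ^ 2) + 37 * Q := by
    linarith only [hmain, hjump, hnotP', h2Q]
  have hTe : Real.exp 1 ≤ T := hθe.trans (theta_le_bigT hm0)
  have he2 : (2:ℝ) < Real.exp 1 := by have := Real.exp_one_gt_d9; linarith
  have hT2 : 2 ≤ T := by linarith
  have hT0 : 0 < T := by linarith
  have hy0 : 0 < y := by linarith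
  have hy14 : 0 ≤ y ^ ((1:ℝ)/4) := Real.rpow_nonneg hy0.le _
  by_cases hcase : Real.sqrt y ≤ T
  · linarith
  push Not at hcase
  have hsy : Real.exp 1 ≤ Real.sqrt y := by linarith
  have htan := mul_div_log_le_liSq_sub hTe hsy
  have hlsq : logIntegral y = liSq (Real.sqrt y) + logIntegral 4 := by
    have := logIntegral_sq_eq (show (2:ℝ) ≤ Real.sqrt y by linarith)
    rwa [Real.sq_sqrt hy0.le] at this
  have hlT : logIntegral (T ^ 2) = liSq T + logIntegral 4 := logIntegral_sq_eq hT2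
  have hdiff : liSq (Real.sqrt y) - liSq T < 37 * Q := by
    rw [hyn] at hlsq; linarith only [hlsq, hlT, hli]
  have hlogT : 0 < Real.log T := Real.log_pos (by linarith)
  have h1 : (Real.sqrt y - T) * T < 37 * Q * Real.log T := by
    have h := lt_of_le_of_lt htan hdiff
    have := mul_lt_mul_of_pos_right h hlogT
    have e : (Real.sqrt y - T) * (T / Real.log T) * Real.log T = (Real.sqrt y - T) * T := by
      field_simp
    linarith only [this, e]
  -- sizes
  have hm1 : (1:ℝ) ≤ m := by linarith [Real.add_one_le_exp (140:ℝ)]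
  have hlm : 140 ≤ Real.log m := by rw [Real.le_log_iff_exp_le (by linarith)]; exact hme
  have hlm0 : 0 < Real.log m := by linarith
  have hlogT_le : Real.log T ≤ 1.01 * Real.log m := by
    have h2 : Real.log T ≤ Real.log (1.002 * m) := Real.log_le_log hT0 hThi
    rw [Real.log_mul (by norm_num) (by linarith)] at h2
    have h3 : Real.log 1.002 ≤ 0.002 := by
      have := Real.log_le_sub_one_of_pos (show (0:ℝ) < 1.002 by norm_num); linarith
    nlinarith
  have hsm : 0 ≤ Real.sqrt (m:ℝ) := Real.sqrt_nonneg _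
  have hQlog : Q * Real.log T ≤ 1.01 * ((m:ℝ) * Real.sqrt m) := by
    calc Q * Real.log T ≤ Q * (1.01 * Real.log m) :=
          mul_le_mul_of_nonneg_left hlogT_le (by positivity)
      _ = 1.01 * ((m:ℝ) * Real.sqrt m) := by rw [hQdef]; field_simp
  have hTm : 0.999 * m ≤ T := hθlo.trans (theta_le_bigT hm0)
  have h2 : Real.sqrt y - T < 37.5 * Real.sqrt m := by
    by_contra h
    push Not at h
    have h3 : 37.5 * Real.sqrt m * (0.999 * m) ≤ (Real.sqrt y - T) * T :=
      mul_le_mul h hTm (by positivity) (by linarith)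
    have e3 : 37.5 * Real.sqrt m * (0.999 * m) = 37.4625 * ((m:ℝ) * Real.sqrt m) := by ring
    have hs1 : 1 ≤ Real.sqrt (m:ℝ) := by
      rw [Real.le_sqrt (by norm_num) hm0]; linarith
    have hmm : 1 ≤ (m:ℝ) * Real.sqrt m := one_le_mul_of_one_le_of_one_le hm1 hs1
    have h5 := mul_le_mul_of_nonneg_left hQlog (by norm_num : (0:ℝ) ≤ 37)
    linarith only [h1, h5, h3, e3, hmm]
  -- `√m ≤ 1.001 y^{1/4}`
  have h4 : Real.sqrt (m:ℝ) ≤ 1.001 * y ^ ((1:ℝ)/4) := by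
    have hm_le : (m:ℝ) ≤ 1.002 * Real.sqrt y := by
      have := Real.sqrt_nonneg y; linarith
    have h5 : Real.sqrt (m:ℝ) ≤ Real.sqrt (1.002 * Real.sqrt y) := Real.sqrt_le_sqrt hm_le
    have hss : Real.sqrt (Real.sqrt y) = y ^ ((1:ℝ)/4) := by
      rw [Real.sqrt_eq_rpow, Real.sqrt_eq_rpow, ← Real.rpow_mul hy0.le]; norm_num
    have h6 : Real.sqrt (1.002 * Real.sqrt y) = Real.sqrt 1.002 * y ^ ((1:ℝ)/4) := by
      rw [Real.sqrt_mul (by norm_num), hss]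
    have h7 : Real.sqrt (1.002:ℝ) ≤ 1.001 := by
      rw [Real.sqrt_le_iff]; norm_num
    rw [h6] at h5
    have := mul_le_mul_of_nonneg_right h7 hy14
    linarith
  have h8 := mul_le_mul_of_nonneg_left h4 (by norm_num : (0:ℝ) ≤ 37.5)
  linarith only [hT, h2, h8, hy14]


/-! ## §12 From `(li⁻¹ n)^{1/4}` to `(n log n)^{1/4}`: MNR Thm 1 (i) under RH, as printed -/

/-- `li⁻¹(n) ≤ 6 n log n` for large `li⁻¹(n)` (from `li y ∼ y/log y`). [cite: MassiasNicolasRobin1988, §2 (Li⁻¹ asymptotics)] -/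
theorem liInv_le_mul : ∃ Y : ℝ, ∀ y : ℝ, Y ≤ y → ∀ n : ℕ, logIntegral y = n →
    y ≤ 6 * ((n:ℝ) * Real.log n) := by
  have h := (isEquivalent_logIntegral_holds).isLittleO.def (show (0:ℝ) < 1/2 by norm_num)
  rw [Filter.eventually_atTop] at h
  obtain ⟨Y₀, hY₀⟩ := h
  refine ⟨max Y₀ 4096, fun y hy n hyn ↦ ?_⟩
  have hyY : Y₀ ≤ y := (le_max_left _ _).trans hy
  have hy4 : (4096:ℝ) ≤ y := (le_max_right _ _).trans hy
  have hy0 : 0 < y := by linarith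
  have hly : 0 < Real.log y := Real.log_pos (by linarith)
  have h1 := hY₀ y hyY
  simp only [Pi.sub_apply, Real.norm_eq_abs] at h1
  rw [abs_of_pos (div_pos hy0 hly)] at h1
  -- `li y ≥ y/(2 log y)`
  have hli : y / Real.log y / 2 ≤ logIntegral y := by
    have := (abs_le.1 h1).1; linarith
  rw [hyn] at hli
  -- `log y ≤ 2 √y`, so `√y ≤ 4 n`, `y ≤ 16 n²`, `log y ≤ 3 log n`
  have hsy : 0 < Real.sqrt y := Real.sqrt_pos.2 hy0
  have hsy2 : Real.sqrt y * Real.sqrt y = y := Real.mul_self_sqrt hy0.le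
  have hlog_sqrt : Real.log y ≤ 2 * Real.sqrt y := by
    have e : Real.log y = 2 * Real.log (Real.sqrt y) := by
      rw [Real.log_sqrt hy0.le]; ring
    have := Real.log_le_sub_one_of_pos hsy
    linarith
  have hn1 : y ≤ 2 * n * Real.log y := by
    have := hli; rw [div_div, div_le_iff₀ (by positivity)] at this; linarith
  have hsn : Real.sqrt y ≤ 4 * n := by nlinarith
  have hs64 : (64:ℝ) ≤ Real.sqrt y := Real.le_sqrt_of_sq_le (by nlinarith)
  have hn16 : (16:ℝ) ≤ n := by linarith
  have hn0 : (0:ℝ) < n := by linarith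
  have hly2 : Real.log y ≤ Real.log 16 + 2 * Real.log n := by
    have e1 : Real.log y = 2 * Real.log (Real.sqrt y) := by rw [Real.log_sqrt hy0.le]; ring
    have e2 : Real.log (Real.sqrt y) ≤ Real.log (4 * n) := Real.log_le_log hsy hsn
    rw [Real.log_mul (by norm_num) hn0.ne'] at e2
    have e3 : Real.log 16 = 2 * Real.log 4 := by
      rw [show (16:ℝ) = 4 ^ 2 by norm_num, Real.log_pow]; push_cast; ring
    linarith
  have hl16 : Real.log 16 ≤ Real.log n := Real.log_le_log (by norm_num) hn16
  have hly3 : Real.log y ≤ 3 * Real.log n := by linarith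
  nlinarith

/-- `6^{1/4} ≤ 1.566`. [folklore] -/
private theorem rpow_six_quarter_le : (6:ℝ) ^ ((1:ℝ)/4) ≤ 1.566 := by
  by_contra h
  push Not at h
  have h0 : (0:ℝ) ≤ 1.566 := by norm_num
  have h1 : (1.566:ℝ) ^ 4 < ((6:ℝ) ^ ((1:ℝ)/4)) ^ 4 := pow_lt_pow_left₀ h h0 (by norm_num)
  have h2 : ((6:ℝ) ^ ((1:ℝ)/4)) ^ 4 = 6 := by
    rw [← Real.rpow_natCast, ← Real.rpow_mul (by norm_num)]; norm_num
  rw [h2] at h1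
  norm_num at h1

/-- **MNR 1988, Thm. 1 (i) in the RH case, with an explicit constant**: under RH,
`|log g(n) − √(li⁻¹(n))| ≤ 60 (n log n)^{1/4}` for all large `n` (MNR: `log g(n) = √(Li⁻¹(n)) +
O((n log n)^{θ/2})` for `θ < 1`; `θ = 1/2` under RH). Upper side from Thm. 1 (iv), lower side from
`sqrt_sub_rpow_le_log_landauFn_of_riemannHypothesis` and `li⁻¹ n ≤ 6 n log n`.
[cite: MassiasNicolasRobin1988, Thm. 1 (i) (θ = 1/2 under RH)] -/
theorem abs_log_landauFn_sub_sqrt_le_of_riemannHypothesis (hRH : RiemannHypothesis) :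
    ∃ n₀ : ℕ, ∀ n : ℕ, n₀ ≤ n → ∀ y : ℝ, 1 < y → logIntegral y = n →
      |Real.log (landauFn n) - Real.sqrt y| ≤ 60 * ((n:ℝ) * Real.log n) ^ ((1:ℝ)/4) := by
  obtain ⟨n₁, h1⟩ := eventually_log_landauFn_lt_of_riemannHypothesis hRH
  obtain ⟨n₂, h2⟩ := sqrt_sub_rpow_le_log_landauFn_of_riemannHypothesis hRH
  obtain ⟨Y, hY⟩ := liInv_le_mul
  -- `y ≥ Y` as soon as `n > li (max Y 2)`
  set Y' := max Y 2 with hY'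
  refine ⟨max (max n₁ n₂) (⌈logIntegral Y'⌉₊ + 1), fun n hn y hy hyn ↦ ?_⟩
  have hn1 : n₁ ≤ n := ((le_max_left _ _).trans (le_max_left _ _)).trans hn
  have hn2 : n₂ ≤ n := ((le_max_right _ _).trans (le_max_left _ _)).trans hn
  have hn3 : ⌈logIntegral Y'⌉₊ + 1 ≤ n := (le_max_right _ _).trans hn
  have hup := h1 n hn1 y hy hyn
  have hlo := h2 n hn2 y hy hyn
  have hy0 : 0 < y := by linarith
  -- `Y' < y`
  have hyY : Y' ≤ y := by
    by_contra h
    push Not at h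
    have hmono : StrictMonoOn logIntegral (Set.Ioi 1) := strictMonoOn_logIntegral_holds
    have hY1 : (1:ℝ) < Y' := lt_of_lt_of_le one_lt_two (le_max_right _ _)
    have := hmono (show y ∈ Set.Ioi (1:ℝ) from hy) (show Y' ∈ Set.Ioi (1:ℝ) from hY1) h
    rw [hyn] at this
    have h4 : (n:ℝ) < ⌈logIntegral Y'⌉₊ := this.trans_le (Nat.le_ceil _)
    have h5 : (⌈logIntegral Y'⌉₊ : ℝ) + 1 ≤ n := by exact_mod_cast hn3
    linarith
  have hy6 := hY y ((le_max_left _ _).trans hyY) n hyn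
  have hnl0 : 0 ≤ (n:ℝ) * Real.log n := by
    have : (0:ℝ) ≤ y / 6 := by positivity
    nlinarith
  -- `y^{1/4} ≤ (6 n log n)^{1/4} ≤ 1.566 (n log n)^{1/4}`
  have hq : y ^ ((1:ℝ)/4) ≤ 1.566 * ((n:ℝ) * Real.log n) ^ ((1:ℝ)/4) := by
    calc y ^ ((1:ℝ)/4) ≤ (6 * ((n:ℝ) * Real.log n)) ^ ((1:ℝ)/4) :=
          Real.rpow_le_rpow hy0.le hy6 (by norm_num)
      _ = (6:ℝ) ^ ((1:ℝ)/4) * ((n:ℝ) * Real.log n) ^ ((1:ℝ)/4) :=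
          Real.mul_rpow (by norm_num) hnl0
      _ ≤ 1.566 * ((n:ℝ) * Real.log n) ^ ((1:ℝ)/4) :=
          mul_le_mul_of_nonneg_right rpow_six_quarter_le (Real.rpow_nonneg hnl0 _)
  have hq0 : 0 ≤ ((n:ℝ) * Real.log n) ^ ((1:ℝ)/4) := Real.rpow_nonneg hnl0 _
  rw [abs_le]
  constructor <;> linarith

end LandauFnUpperRH

end Literature.NumberTheory.LFunctions
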